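import Summits.HodgeConjecture.HodgeConjecture.Cruxes.BlochSeedDiscOne.SeedCheckerSplitBlockQ1Shell
import Summits.HodgeConjecture.HodgeConjecture.Cruxes.BlochSeedDiscOne.PortHallGRow

/-!
line stmt-HodgeConjecture-18881 Cruxes/BlochSeedDiscOne/Lines/birth.lean 814a6a70c14e831a stub_rung_pad4_seedAt

# TheoremQ1Kernel v2 — the (Q1-k ∕ Q1-k′) docket of director-hodge g33 (R19.912 l.14072, R19.917 l.14118, R19.918 l.14124, R19.920 l.14150,
# R19.923 l.14189 = AMENDMENT 3, R19.927 l.14230) to hsemireg-c5c8-1 g56 (2026-08-31): THEOREM Q1 of plan-lens-HodgeAV-negation g26 (memo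
# `PORTHALL8-ROW-A2-negation-g26.md` v1.6 961a4a2f27abe983 … v1.8 1054a65eba936fc6 §4quinquies, pen text unchanged: THEOREM G (a) ⟹ (c), LEMMA L)
# in the kernel — ONE VOCABULARY with negation's `PortHallGRow.lean` v2 d16bfab8432ec171 @94bc704371c6 (R19.923: clause (c) = `PortHallG.GClean`).

Imports `SeedCheckerSplitBlockQ1Shell` (BUILT, 73396e630221274f) and `PortHallGRow` (v2 d16bfab8432ec171; this file uses of it only the §1 objects
`senders receivers gammaU seenBy subl mass factorRank stepsAt gRank grow reach connB numCompAux verts numComp witnessB gCleanB GClean`, byte-identical in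
v1 eef21cfe8ae80a61 and v2, plus v2's guarded `LemmaL` and `TheoremG` by name; BUILT 19:44:31Z, R19.928).  ADDITIVE vocabulary ∕ proof
file; supersedes this path's v1.1 cb0e55cd9e29687d @f7b59fd4dcf5 (officer PLATE #126 PASS-WITH-PRICE (p): «the owed bridge `lawC_of_gClean`» — PAID
here in kernel, §A.8); touches no `Lines/*`, redeclares nothing of another module, no `instance`, no notation, no new axiom, no unsafe option,
no `native_decide`.  Words by director-hodge only.

## 0. FINDING (kernel): `SeedChecker.SplitBlock.TheoremQ1` AS TYPED IS FALSE — `not_theoremQ1` (= negation's `PortHallG.not_lemmaL_unguarded` one level up).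
`TheoremQ1 := ∀ D : DepthBoundA4.Design, PPClean weakB D → HallPlusLegUp D` fails on `Q1Kernel.Ddup := ⟨[(y3,1),(y3,1)], [(xn4,1)]⟩` (= negation's
`PortHallG.Ddup`; `PatternedPorteous.NUL4m1n2` with its N entry `(y3, 2)` split into two EXACTLY EQUAL list entries): `ppCleanB weakB Ddup = true`
(`decide +kernel`: LAW PP aggregates masses per cell) while `¬ HallPlusLegUp Ddup` (`S = [(xn4,1)]`, `T = [(y3,1)] ⊑ N` satisfies the row's covering
clause `cn ∈ T` by MEMBERSHIP, `d = 1 ≤ pairDim xn4 y3 = 1`, `1 + 1 ≤ 1` fails).  CLASS: misstated at the LIST level (memo v1.8 §4quinquies (F):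
designs are multisets of pairwise-distinct cells; the list shells `TheoremQ1` ∕ v1-`LemmaL` refuted-MISSTATED, void on shadows: `shadow_N_nodup`).
DEGENERATE-LIST BATTERY (officer g29 l.14121 ∕ R19.918; kernel, §A.0; negation's §3b and the officer's AUDIT 143 batteries agree): `Ddup` (PP ✓, row ✗
— the ONE failure, killed by `Nodup`); `Dsplit = ⟨[(y3,1),(y3,2)],[(xn4,1)]⟩` (PP ✓, row ✓), `Dsplit1` (PP ✗); `Dzero1–3`; `DemptyN` (PP ✗: the empty-union
item catches receiver-less senders), `DemptyP`, `Dempty` (PP ✓, row vacuous); `Ddead` (PP ✗).  Wherever the row fails, PP fails: the PAIR-level `D.N.Nodup`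
(weaker than the cell-level `(D.N.map Prod.fst).Nodup` of shadows — `shadow_N_cells_nodup`, `nodup_of_cells_nodup`) is the one hypothesis (R19.918 (r)).

## 1. THE REPAIRED STATEMENT `TheoremQ1N := ∀ D, D.N.Nodup → PPClean weakB D → HallPlusLegUp D` and its proof tree (R19.923 (0)–(3))
* `gClean_of_ppClean : PPClean weakB D → PortHallG.GClean D` (UNGUARDED; THEOREM G forward, (a) ⟹ (c)) — **THE ONE NAMED `sorry` OF THIS FILE**, the
  sorry of record.  Pen proof GEOMETRIC ((a) ⟹ (b): induction on `|T|`, regular display sections, Whitney ∕ [Fulton, Thm 14.4(a), Prop. 14.1(b)];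
  (b) ⟹ (c): the stratum criterion via Kleiman–Bertini on `∏ ℙ_τ`, the algebraic polymatroid of `Ȳ` + [CCLMZ20 Thm A], monad-3 LEMMA C); no
  letter-ring (kernel-internal) route in print; fill judged > 2 sessions (R19.912 fallback).
* `lemmaL : PortHallG.LemmaL` (negation's GUARDED v2 statement BY NAME, `= ∀ E, E.N.Nodup → GClean E → HallPlusLegUp E`) — **KERNEL, 0 sorry**
  (R19.923 (3) «THE REAL WORK»), as the composite of three kernel theorems of Part A:
  (i) §A.8 THE BRIDGE = CHECKER SOUNDNESS `Q1Kernel.lawC_of_gClean : GClean D → LawC D` (negation's computable row implies the Prop-level clause (c):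
      `subl` enumerates the sub-lists (B.1); `gCleanB` hands a witness `𝔍'` for the lift `U'` of a sender set `U` (B.2); entry masses vs per-cell masses
      (B.3); the type-level joint rank `jrank ≤ gRank` — `factorRank` of the collected step kinds, with transitivity of proportionality of non-zero null
      vectors (B.4); and the cost centre named by R19.927, the SPEC LEMMA OF THE FUELLED BFS: `numComp_le_card_labels` — the first-seed labelling `labv`
      is constant along live arrows and `numCompAux` counts at most its labels, via `front_closed` (the front `reach V |V| [v]` is closed under adjacency:
      a strictly increasing chain of fronts inside `V` has length `≤ |V|`), `rch_meet` (reflexive ∕ transitive ∕ symmetric reachability),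
      `labv_eq_of_adj`, `connB_of_labv_eq`, `numCompAux_le` (B.5));
  (ii) §A.4–A.5 LEMMA L PROPER `Q1Kernel.legIneq_of_lawC : LawC D → LegIneq D` (the pigeonhole over blocks `lawW_of_lawC` + strong induction on `|S|`);
  (iii) §A.6 THE TRANSLATION `Q1Kernel.hallPlusLegUp_of_legIneq : D.N.Nodup → LegIneq D → HallPlusLegUp D` (`Nodup` is exactly what makes the typed
      row the memo's row).
  `Q1Kernel.LawC` (Prop, per-cell masses, `CrossFree` labellings, `jrank`) is thereby NOT a second row but the proof's normal form of `GClean`, with the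
  kernel bridge between them (officer's price (p) of PLATE #126 discharged).
* `theoremQ1N : TheoremQ1N := fun D hN hpp => lemmaL D hN (gClean_of_ppClean D hpp)` — R19.923's three-token composition; PRESENT, **NOT CLOSED**
  (sorry-fed through `gClean_of_ppClean` only); `theoremQ1N_of_G_L hG hL` and `theoremQ1N_of hC` are the sorry-free compositions; `theoremQ1Nc` the
  cell-level-guard corollary.  Cite `theoremQ1N` only after this module's farm audit shows 0 sorries.  Consumer of record then:
  `stub_legRow := legRow_of_ppRow_of_q1N_picZero theoremQ1N stub_ppRow` (v4 literal statements, `Nodup` discharged inside by `shadow_N_nodup`).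
* KERNEL sanity of the constants (§A.7): `lawC_NUL4m1n2` (TIGHT: `2 + 1 = 1 + 1 + 1`), `not_lawC_NUL4m1n1`.
* NOT written here (R19.923 (0)): `not_lemmaL` — negation's `PortHallG.not_lemmaL_unguarded` is the kernel record that v1's unguarded `LemmaL` is false.

TYPED-NOT-PROVED after this file (J-list wording of R19.927): THEOREM G typed `PortHallG.TheoremG` (unguarded; its forward half is `gClean_of_ppClean`
here) · THEOREM Q1 typed `TheoremQ1N` (closed iff THEOREM G forward is).  NO LONGER typed-not-proved: LEMMA L (`PortHallG.LemmaL` v2) — `lemmaL` here.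
Refuted-as-typed record: `TheoremQ1` (`not_theoremQ1`), v1-`LemmaL` (`PortHallG.not_lemmaL_unguarded`).

HONEST REGISTER.  Letter-model bookkeeping (multiplicities, classes, the live relation) and finite graph theory on `DepthBoundA4.Design`; a letter design
≠ a display ≠ a sheaf ≠ a SEED.  NOTHING here is proved toward HC ∕ HC_CM ∕ HC_AV ∕ №4 ∕ 26512 ∕ 18881 ∕ H2; `stub_rung_pad4_seedAt`, `stub_rung2a`,
`stub_ppRow`, `stub_legRow` untouched and OPEN; typed ≠ proved; registered ≠ closed.  One `sorry` (named: `gClean_of_ppClean`), no axiom, no `instance`,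
no notation, no `native_decide`; `decide +kernel` only on the ≤ 4-entry designs of §A.0.
-/

set_option linter.dupNamespace false
set_option autoImplicit false

/-! ## Part A — combinatorics on `DepthBoundA4.Design`: the counterexample, clause (c), LEMMA L, the list translation -/

namespace Summit.HodgeConjecture.HodgeConjecture.Cruxes.BlochSeedDiscOne.Q1Kernel

open Summit.HodgeConjecture.HodgeConjecture.Cruxes.BlochSeedDiscOne.DepthBoundA4
open Summit.HodgeConjecture.HodgeConjecture.Cruxes.BlochSeedDiscOne.PatternedPorteous (weakB weakB_iff PPClean ppCleanB y3 xn4)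
open Summit.HodgeConjecture.HodgeConjecture.Cruxes.BlochSeedDiscOne.PortHallLeg
open Finset

/-! ### A.0 The duplicate-entry counterexample to `TheoremQ1` as typed -/

section Counterexample

/-- `NUL4-m1n2` with its N entry `(y3, 2)` split into two exactly equal entries. -/
def Ddup : Design := ⟨[(y3, 1), (y3, 1)], [(xn4, 1)]⟩

/-- LAW PP passes (aggregated masses `n = 2`, `m = 1`; the null leg is clean at surplus 1). [`decide +kernel`] -/
theorem ddup_ppCleanB : ppCleanB weakB Ddup = true := by decide +kernel

theorem ddup_ppClean : PPClean weakB Ddup := ddup_ppCleanB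

theorem ddup_pairDim : pairDim xn4 y3 = 1 := by decide

theorem ddup_weakLive : WeakLive xn4 y3 := (weakB_iff _ _).1 (by decide)

/-- … but the typed leg row fails: `T = [(y3, 1)]` covers by membership, and `1 + 1 ≤ 1` is false. -/
theorem ddup_not_hallPlusLegUp : ¬ HallPlusLegUp Ddup := by
  intro h
  have h1 := h [(xn4, 1)] (List.Sublist.refl _) (by decide) [(y3, 1)]
    (List.Sublist.cons _ (List.Sublist.refl _))
    (by
      intro cn hcn _
      simp [Ddup] at hcn
      simp [hcn])
    1 (by norm_num)
    (by
      intro cm hcm cn hcn _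
      simp at hcm hcn
      subst hcm; subst hcn
      simp [ddup_pairDim])
  simp at h1

/-- `Ddup` is exactly what the repaired statement's guard excludes. -/
theorem ddup_N_not_nodup : ¬ Ddup.N.Nodup := by decide

/-! #### The officer's degenerate-list battery (l.14121 ∕ R19.918): split multiplicities, zero-multiplicity entries, empty lists, dead receivers -/

/-- split multiplicities: distinct pairs on one cell. PP ✓ (`n = 3`). -/
def Dsplit : Design := ⟨[(y3, 1), (y3, 2)], [(xn4, 1)]⟩
theorem dsplit_pp : ppCleanB weakB Dsplit = true := by decide +kernel
theorem dsplit_N_nodup : Dsplit.N.Nodup := by decide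

/-- split with a zero part: aggregated `n = 1 < 2`. PP ✗. -/
def Dsplit1 : Design := ⟨[(y3, 1), (y3, 0)], [(xn4, 1)]⟩
theorem dsplit1_pp : ppCleanB weakB Dsplit1 = false := by decide +kernel

/-- zero-mass receiver only. PP ✗ (the sender is receiver-less: item `R = ∅`). -/
def Dzero1 : Design := ⟨[(y3, 0)], [(xn4, 1)]⟩
theorem dzero1_pp : ppCleanB weakB Dzero1 = false := by decide +kernel

/-- zero-mass sender only. PP ✓ (no item has senders); the row is vacuous (no positive `S`). -/
def Dzero2 : Design := ⟨[(y3, 2)], [(xn4, 0)]⟩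
theorem dzero2_pp : ppCleanB weakB Dzero2 = true := by decide +kernel

/-- zero-mass entries on both sides next to a clean null leg. PP ✓. -/
def Dzero3 : Design := ⟨[(y3, 2), (PatternedPorteous.x3, 0)], [(xn4, 1), (xn4, 0)]⟩
theorem dzero3_pp : ppCleanB weakB Dzero3 = true := by decide +kernel

/-- empty N with a positive sender. PP ✗ (item `R = ∅`, `T_∅ ∋ (xn4,1)`, `1 ≤ 0` fails). -/
def DemptyN : Design := ⟨[], [(xn4, 1)]⟩
theorem demptyN_pp : ppCleanB weakB DemptyN = false := by decide +kernel

/-- empty P. PP ✓; the row is vacuous. -/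
def DemptyP : Design := ⟨[(y3, 2)], []⟩
theorem demptyP_pp : ppCleanB weakB DemptyP = true := by decide +kernel
theorem demptyP_hallPlusLegUp : HallPlusLegUp DemptyP := by
  intro S hS hpos
  have hS' : S = [] := List.eq_nil_of_sublist_nil hS
  subst hS'
  simp at hpos

/-- the empty design. PP ✓. -/
def Dempty : Design := ⟨[], []⟩
theorem dempty_pp : ppCleanB weakB Dempty = true := by decide +kernel

/-- dead receiver: sender `y3`, the only receiver `xn4` is NOT weakly live from it. PP ✗ (item `R = ∅`). -/
def Ddead : Design := ⟨[(xn4, 3)], [(y3, 1)]⟩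
theorem ddead_not_weak : weakB y3 xn4 = false := by decide
theorem ddead_pp : ppCleanB weakB Ddead = false := by decide +kernel

end Counterexample

/-! ### A.1 Aggregated masses, senders, receivers, `Γ`, `U(𝔍)` -/

section Clauses

open scoped Classical

variable (D : Design)

/-- aggregated multiplicity of the P-cell `σ` (all list entries with that cell). -/
def mP (σ : Cell) : ℕ := (D.P.map fun e => if e.1 = σ then e.2 else 0).sum

/-- aggregated multiplicity of the N-cell `τ`. -/
def mN (τ : Cell) : ℕ := (D.N.map fun e => if e.1 = τ then e.2 else 0).sum

/-- `m(U)`. -/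
def massP (U : Finset Cell) : ℕ := ∑ σ ∈ U, mP D σ

/-- `n(𝔍)`. -/
def massN (J : Finset Cell) : ℕ := ∑ τ ∈ J, mN D τ

/-- sender types `T`: cells of P-entries of positive multiplicity. -/
def senders : Finset Cell := D.suppP.toFinset

/-- receiver types: cells of N-entries of positive multiplicity. -/
def receivers : Finset Cell := D.suppN.toFinset

/-- `Γ(U)`: receiver types weakly live above some cell of `U`. -/
noncomputable def nb (U : Finset Cell) : Finset Cell := (receivers D).filter fun τ => ∃ σ ∈ U, WeakLive σ τ

/-- `U(𝔍)`: the cells of `U` weakly live to some cell of `𝔍`. -/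
noncomputable def seen (U J : Finset Cell) : Finset Cell := U.filter fun σ => ∃ τ ∈ J, WeakLive σ τ

variable {D}

theorem mem_nb {U : Finset Cell} {τ : Cell} : τ ∈ nb D U ↔ τ ∈ receivers D ∧ ∃ σ ∈ U, WeakLive σ τ := by
  unfold nb
  rw [mem_filter]

theorem mem_seen {U J : Finset Cell} {σ : Cell} : σ ∈ seen U J ↔ σ ∈ U ∧ ∃ τ ∈ J, WeakLive σ τ := by
  unfold seen
  rw [mem_filter]

theorem nb_mono {U U' : Finset Cell} (h : U ⊆ U') : nb D U ⊆ nb D U' := by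
  intro τ hτ
  rw [mem_nb] at hτ ⊢
  obtain ⟨h1, σ, hσ, hw⟩ := hτ
  exact ⟨h1, σ, h hσ, hw⟩

theorem seen_subset (U J : Finset Cell) : seen U J ⊆ U := by
  unfold seen
  exact filter_subset _ _

/-! ### A.2 The joint leg rank `g_U(𝔍) = Σ_f r_f` and cross-free block labellings -/

/-- the step of the pair `σ → τ` on factor `f` is isotropic (`Δx² + Δy² = Δa²`; the zero step included). -/
def StepNull (σ τ : Cell) (f : Fin 4) : Prop :=
  ((τ f).x - (σ f).x) ^ 2 + ((τ f).y - (σ f).y) ^ 2 = ((τ f).a - (σ f).a) ^ 2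

/-- the steps of `σ → τ` and `σ' → τ'` on factor `f` are parallel (all `2 × 2` minors of the two `Δ`-vectors vanish). -/
def StepPar (σ τ σ' τ' : Cell) (f : Fin 4) : Prop :=
  ((τ f).a - (σ f).a) * ((τ' f).x - (σ' f).x) = ((τ' f).a - (σ' f).a) * ((τ f).x - (σ f).x) ∧
  ((τ f).a - (σ f).a) * ((τ' f).y - (σ' f).y) = ((τ' f).a - (σ' f).a) * ((τ f).y - (σ f).y) ∧
  ((τ f).x - (σ f).x) * ((τ' f).y - (σ' f).y) = ((τ' f).x - (σ' f).x) * ((τ f).y - (σ f).y)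

/-- `r_f ∈ {0, 1, 2}`: the joint rank on the `f`-th factor of the live steps `{τ_f − σ_f : τ ∈ 𝔍, σ ∈ U live to τ}` (= the codimension of the
connected common kernel of their classes: `0` all zero, `1` all isotropic and pairwise parallel, `2` otherwise). -/
noncomputable def rk (U J : Finset Cell) (f : Fin 4) : ℕ :=
  if ∀ σ ∈ U, ∀ τ ∈ J, WeakLive σ τ → σ f = τ f then 0
  else if (∀ σ ∈ U, ∀ τ ∈ J, WeakLive σ τ → StepNull σ τ f) ∧
      (∀ σ ∈ U, ∀ τ ∈ J, ∀ σ' ∈ U, ∀ τ' ∈ J, WeakLive σ τ → WeakLive σ' τ' → StepPar σ τ σ' τ' f) then 1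
  else 2

/-- `g_U(𝔍) = Σ_f r_f`. -/
noncomputable def jrank (U J : Finset Cell) : ℕ := rk U J 0 + rk U J 1 + rk U J 2 + rk U J 3

theorem rk_le_two (U J : Finset Cell) (f : Fin 4) : rk U J f ≤ 2 := by
  unfold rk
  split_ifs <;> omega

theorem jrank_le_eight (U J : Finset Cell) : jrank U J ≤ 8 := by
  have h0 := rk_le_two U J 0
  have h1 := rk_le_two U J 1
  have h2 := rk_le_two U J 2
  have h3 := rk_le_two U J 3
  unfold jrank
  omega

/-- fact (1) of LEMMA L: the leg dimension of any live pair is at most the joint rank (`r_f ≥ legDim` factor by factor). -/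
theorem legDim_le_rk {U J : Finset Cell} {σ τ : Cell} (hσ : σ ∈ U) (hτ : τ ∈ J) (hw : WeakLive σ τ) (f : Fin 4) :
    legDim (σ f) (τ f) ≤ rk U J f := by
  unfold rk
  split_ifs with h0 h1
  · rw [h0 σ hσ τ hτ hw, legDim_self]
  · have hn : StepNull σ τ f := h1.1 σ hσ τ hτ hw
    unfold StepNull at hn
    unfold legDim
    split_ifs <;> omega
  · exact legDim_le_two _ _

theorem pairDim_le_jrank {U J : Finset Cell} {σ τ : Cell} (hσ : σ ∈ U) (hτ : τ ∈ J) (hw : WeakLive σ τ) :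
    pairDim σ τ ≤ jrank U J := by
  have h0 := legDim_le_rk hσ hτ hw 0
  have h1 := legDim_le_rk hσ hτ hw 1
  have h2 := legDim_le_rk hσ hτ hw 2
  have h3 := legDim_le_rk hσ hτ hw 3
  unfold pairDim jrank
  omega

/-- a CROSS-FREE block labelling of the live bipartite graph on `U ⊔ 𝔍`: live pairs carry equal labels (so every connected component is
monochromatic, and the number of labels met on `𝔍` is at most the number of components `c_U(𝔍)`; the component labelling attains it). -/
def CrossFree (U J : Finset Cell) (κ : Cell → ℕ) : Prop :=
  ∀ σ ∈ U, ∀ τ ∈ J, WeakLive σ τ → κ σ = κ τ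

/-! ### A.3 The three clauses -/

variable (D)

/-- **THEOREM G clause (c) — the PROP-LEVEL SPECIFICATION** (memo §4quinquies; the computable ROW OF RECORD is negation's `PortHallG.GClean` ∕
`gCleanB`, `PortHallGRow.lean` v2 d16bfab8432ec171 — this is its proof-side normal form, not a second row; the kernel bridge is `lawC_of_gClean`, §A.8): for every non-empty set `U` of sender types
there are a non-empty `𝔍 ⊆ Γ(U)` and a cross-free block labelling `κ` with `n(𝔍) + c ≥ m(U(𝔍)) + 1 + g_U(𝔍)`, `c` = the number of labels met on `𝔍`.
(With the component labelling this is the memo's `n_𝔍 ≥ m(U(𝔍)) − c_U(𝔍) + 1 + g_U(𝔍)` verbatim; a coarser labelling only strengthens the demand;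
masses aggregated per CELL, so entry-level = type-level.) -/
def LawC : Prop :=
  ∀ U : Finset Cell, U.Nonempty → U ⊆ senders D →
    ∃ J : Finset Cell, J.Nonempty ∧ J ⊆ nb D U ∧
      ∃ κ : Cell → ℕ, CrossFree U J κ ∧
        massP D (seen U J) + 1 + jrank U J ≤ massN D J + (J.image κ).card

/-- **the LEMMA-L-ready witness form** (what LEMMA L's case split extracts from (c)): a non-empty sender block `A ⊆ S` and receivers `B ⊆ Γ(S)`
that no sender of `S ∖ A` is live to, with EITHER a live pair `(σ, τ) ∈ A × B` and `n(B) ≥ m(A) + min(8, pairDim σ τ)` (the one-component case)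
OR `A ≠ S` and `n(B) ≥ m(A)` (a component of a ≥ 2-component witness). -/
def LawW : Prop :=
  ∀ S : Finset Cell, S.Nonempty → S ⊆ senders D →
    ∃ A : Finset Cell, A ⊆ S ∧ A.Nonempty ∧ ∃ B : Finset Cell, B ⊆ nb D S ∧
      (∀ σ ∈ S, σ ∉ A → ∀ τ ∈ B, ¬ WeakLive σ τ) ∧
      ((∃ σ ∈ A, ∃ τ ∈ B, WeakLive σ τ ∧ massP D A + min 8 (pairDim σ τ) ≤ massN D B) ∨
       (A ≠ S ∧ massP D A ≤ massN D B))

/-- **the aggregated leg inequality** (LEMMA L's conclusion): for every non-empty sender set `U` and every `d ≤ 8` not exceeding the leg dimension of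
any live pair of `U × Γ(U)`, `m(U) + d ≤ n(Γ(U))`. -/
def LegIneq : Prop :=
  ∀ U : Finset Cell, U.Nonempty → U ⊆ senders D →
    ∀ d : ℕ, d ≤ 8 → (∀ σ ∈ U, ∀ τ ∈ nb D U, WeakLive σ τ → d ≤ pairDim σ τ) →
      massP D U + d ≤ massN D (nb D U)

variable {D}

/-! ### A.4 (c) ⟹ witness form (the pigeonhole over blocks) -/

theorem lawW_of_lawC (h : LawC D) : LawW D := by
  intro S hSne hSsub
  obtain ⟨J, hJne, hJsub, κ, hcross, hineq⟩ := h S hSne hSsub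
  have hlive : ∀ τ ∈ J, ∃ σ ∈ S, WeakLive σ τ := fun τ hτ => (mem_nb.1 (hJsub hτ)).2
  by_cases hi : massP D (seen S J) + jrank S J ≤ massN D J
  · -- one block suffices: A = S(𝔍), B = 𝔍
    obtain ⟨τ₀, hτ₀⟩ := hJne
    obtain ⟨σ₀, hσ₀S, hw₀⟩ := hlive τ₀ hτ₀
    have hσ₀ : σ₀ ∈ seen S J := mem_seen.2 ⟨hσ₀S, τ₀, hτ₀, hw₀⟩
    refine ⟨seen S J, seen_subset S J, ⟨σ₀, hσ₀⟩, J, hJsub, ?_, Or.inl ⟨σ₀, hσ₀, τ₀, hτ₀, hw₀, ?_⟩⟩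
    · intro σ hσS hσA τ hτ hw
      exact hσA (mem_seen.2 ⟨hσS, τ, hτ, hw⟩)
    · have h1 := pairDim_le_jrank hσ₀S hτ₀ hw₀
      have h2 : min 8 (pairDim σ₀ τ₀) ≤ pairDim σ₀ τ₀ := min_le_right _ _
      omega
  · -- at least two blocks: pigeonhole
    push Not at hi
    have hmapJ : ∀ τ ∈ J, κ τ ∈ J.image κ := fun τ hτ => mem_image_of_mem κ hτ
    have hmapA : ∀ σ ∈ seen S J, κ σ ∈ J.image κ := by
      intro σ hσ
      obtain ⟨hσS, τ, hτ, hw⟩ := mem_seen.1 hσ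
      rw [hcross σ hσS τ hτ hw]
      exact hmapJ τ hτ
    have hsumN : ∑ ℓ ∈ J.image κ, massN D (J.filter fun τ => κ τ = ℓ) = massN D J := by
      unfold massN
      exact sum_fiberwise_of_maps_to hmapJ _
    have hsumP : ∑ ℓ ∈ J.image κ, massP D ((seen S J).filter fun σ => κ σ = ℓ) = massP D (seen S J) := by
      unfold massP
      exact sum_fiberwise_of_maps_to hmapA _
    have hblock : ∃ ℓ ∈ J.image κ,
        massP D ((seen S J).filter fun σ => κ σ = ℓ) ≤ massN D (J.filter fun τ => κ τ = ℓ) := by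
      by_contra hno
      push Not at hno
      have hle : ∑ ℓ ∈ J.image κ, (massN D (J.filter fun τ => κ τ = ℓ) + 1) ≤
          ∑ ℓ ∈ J.image κ, massP D ((seen S J).filter fun σ => κ σ = ℓ) :=
        sum_le_sum fun ℓ hℓ => hno ℓ hℓ
      rw [sum_add_distrib, hsumN, hsumP, sum_const, smul_eq_mul, mul_one] at hle
      omega
    obtain ⟨ℓ, hℓ, hle⟩ := hblock
    obtain ⟨τ₁, hτ₁J, hκτ₁⟩ := mem_image.1 hℓ
    obtain ⟨σ₁, hσ₁S, hw₁⟩ := hlive τ₁ hτ₁J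
    have hσ₁A : σ₁ ∈ (seen S J).filter fun σ => κ σ = ℓ := by
      rw [mem_filter]
      exact ⟨mem_seen.2 ⟨hσ₁S, τ₁, hτ₁J, hw₁⟩, by rw [hcross σ₁ hσ₁S τ₁ hτ₁J hw₁, hκτ₁]⟩
    have hc : 1 < (J.image κ).card := by omega
    obtain ⟨a, ha, b, hb, hab⟩ := one_lt_card.1 hc
    have hℓ' : ∃ ℓ' ∈ J.image κ, ℓ' ≠ ℓ := by
      by_cases ha' : a = ℓ
      · exact ⟨b, hb, fun hb' => hab (ha'.trans hb'.symm)⟩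
      · exact ⟨a, ha, ha'⟩
    obtain ⟨ℓ', hℓ'L, hne⟩ := hℓ'
    obtain ⟨τ₂, hτ₂J, hκτ₂⟩ := mem_image.1 hℓ'L
    obtain ⟨σ₂, hσ₂S, hw₂⟩ := hlive τ₂ hτ₂J
    have hσ₂notA : σ₂ ∉ (seen S J).filter fun σ => κ σ = ℓ := by
      intro hmem
      rw [mem_filter] at hmem
      apply hne
      rw [← hκτ₂, ← hcross σ₂ hσ₂S τ₂ hτ₂J hw₂, hmem.2]
    refine ⟨(seen S J).filter fun σ => κ σ = ℓ, (filter_subset _ _).trans (seen_subset S J), ⟨σ₁, hσ₁A⟩,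
      J.filter fun τ => κ τ = ℓ, (filter_subset _ _).trans hJsub, ?_, Or.inr ⟨?_, hle⟩⟩
    · intro σ hσS hσA τ hτ hw
      rw [mem_filter] at hτ
      apply hσA
      rw [mem_filter]
      exact ⟨mem_seen.2 ⟨hσS, τ, hτ.1, hw⟩, by rw [hcross σ hσS τ hτ.1 hw, hτ.2]⟩
    · intro hEq
      rw [hEq] at hσ₂notA
      exact hσ₂notA hσ₂S

/-! ### A.5 LEMMA L: witness form ⟹ the aggregated leg inequality (strong induction on `|S|`) -/

theorem legIneq_of_lawW (hW : LawW D) : LegIneq D := by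
  suffices H : ∀ n : ℕ, ∀ S : Finset Cell, S.card ≤ n → S.Nonempty → S ⊆ senders D →
      ∀ d : ℕ, d ≤ 8 → (∀ σ ∈ S, ∀ τ ∈ nb D S, WeakLive σ τ → d ≤ pairDim σ τ) →
        massP D S + d ≤ massN D (nb D S) from
    fun U hU hsub d hd hdim => H U.card U le_rfl hU hsub d hd hdim
  intro n
  induction n with
  | zero =>
    intro S hcard hne _ _ _ _
    have := card_pos.2 hne
    omega
  | succ n ih =>
    intro S hcard hne hsub d hd hdim
    obtain ⟨A, hAS, hAne, B, hBsub, hcross, hcase⟩ := hW S hne hsub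
    have hS'sub : S \ A ⊆ S := sdiff_subset
    have hnbS' : nb D (S \ A) ⊆ nb D S := nb_mono hS'sub
    have hdisj : Disjoint B (nb D (S \ A)) := by
      rw [Finset.disjoint_left]
      intro τ hτB hτ'
      obtain ⟨_, σ, hσ, hw⟩ := mem_nb.1 hτ'
      rw [mem_sdiff] at hσ
      exact hcross σ hσ.1 hσ.2 τ hτB hw
    have hunion : massN D B + massN D (nb D (S \ A)) ≤ massN D (nb D S) := by
      unfold massN
      rw [← sum_union hdisj]
      exact sum_le_sum_of_subset (union_subset hBsub hnbS')
    have hsplit : massP D (S \ A) + massP D A = massP D S := by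
      unfold massP
      exact sum_sdiff hAS
    have hcardS' : (S \ A).card ≤ n := by
      have := card_lt_card (sdiff_ssubset hAS hAne)
      omega
    have hIH : (S \ A).Nonempty → massP D (S \ A) + d ≤ massN D (nb D (S \ A)) := fun hne' =>
      ih (S \ A) hcardS' hne' (hS'sub.trans hsub) d hd
        (fun σ hσ τ hτ hw => hdim σ (hS'sub hσ) τ (hnbS' hτ) hw)
    rcases hcase with ⟨σ₀, hσ₀, τ₀, hτ₀, hw₀, hi⟩ | ⟨hne', hii⟩
    · have hd' : d ≤ min 8 (pairDim σ₀ τ₀) := le_min hd (hdim σ₀ (hAS hσ₀) τ₀ (hBsub hτ₀) hw₀)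
      have hB : massN D B ≤ massN D (nb D S) := by
        unfold massN
        exact sum_le_sum_of_subset hBsub
      by_cases hS' : (S \ A).Nonempty
      · have := hIH hS'
        omega
      · have h0 : massP D (S \ A) = 0 := by
          rw [not_nonempty_iff_eq_empty] at hS'
          unfold massP
          rw [hS', sum_empty]
        omega
    · have hS' : (S \ A).Nonempty := sdiff_nonempty.2 fun h' => hne' (Subset.antisymm hAS h')
      have := hIH hS'
      omega

/-- **LEMMA L** (memo v1.6 §4quinquies): clause (c) implies the aggregated leg inequality. -/
theorem legIneq_of_lawC (h : LawC D) : LegIneq D := legIneq_of_lawW (lawW_of_lawC h)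

/-! ### A.6 The list translation: aggregated leg inequality ⟹ the typed row `HallPlusLegUp`, on designs without duplicated N entries -/

theorem finset_sum_list_indicator (l : List (Cell × ℕ)) (U : Finset Cell) :
    ∑ a ∈ U, (l.map fun e => if e.1 = a then e.2 else 0).sum = (l.map fun e => if e.1 ∈ U then e.2 else 0).sum := by
  induction l with
  | nil => simp
  | cons x l ih =>
    simp only [List.map_cons, List.sum_cons, sum_add_distrib, ih, sum_ite_eq]

theorem massP_eq_list (U : Finset Cell) : massP D U = (D.P.map fun e => if e.1 ∈ U then e.2 else 0).sum := by
  unfold massP mP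
  exact finset_sum_list_indicator D.P U

theorem massN_eq_list (J : Finset Cell) : massN D J = (D.N.map fun e => if e.1 ∈ J then e.2 else 0).sum := by
  unfold massN mN
  exact finset_sum_list_indicator D.N J

/-- **the translation**: on a design whose N-list has no duplicated entry, the aggregated leg inequality IS the typed leg row. -/
theorem hallPlusLegUp_of_legIneq (hN : D.N.Nodup) (h : LegIneq D) : HallPlusLegUp D := by
  intro S hS hpos T hT hcov d hd hdim
  -- a positive entry of `S`
  have hex : ∃ e ∈ S, 0 < e.2 := by
    by_contra hno
    push Not at hno
    have h0 : (S.map Prod.snd).sum = 0 := by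
      apply List.sum_eq_zero
      intro x hx
      obtain ⟨e, he, rfl⟩ := List.mem_map.1 hx
      have := hno e he
      omega
    omega
  -- the sender set `U` of `S`
  let U : Finset Cell := ((S.filter fun e => 0 < e.2).map Prod.fst).toFinset
  have memU : ∀ {σ : Cell}, σ ∈ U ↔ ∃ e ∈ S, 0 < e.2 ∧ e.1 = σ := by
    intro σ
    simp only [U, List.mem_toFinset, List.mem_map, List.mem_filter, decide_eq_true_eq]
    constructor
    · rintro ⟨e, ⟨he, hp⟩, h1⟩
      exact ⟨e, he, hp, h1⟩
    · rintro ⟨e, he, hp, h1⟩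
      exact ⟨e, ⟨he, hp⟩, h1⟩
  obtain ⟨e₀, he₀S, he₀pos⟩ := hex
  have hUne : U.Nonempty := ⟨e₀.1, memU.2 ⟨e₀, he₀S, he₀pos, rfl⟩⟩
  have hUsub : U ⊆ senders D := by
    intro σ hσ
    obtain ⟨e, heS, hep, rfl⟩ := memU.1 hσ
    unfold senders Design.suppP
    rw [List.mem_toFinset, List.mem_map]
    exact ⟨e, List.mem_filter.2 ⟨hS.subset heS, by simpa using hep⟩, rfl⟩
  have hdimU : ∀ σ ∈ U, ∀ τ ∈ nb D U, WeakLive σ τ → d ≤ pairDim σ τ := by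
    intro σ hσ τ hτ hw
    obtain ⟨e, heS, _, rfl⟩ := memU.1 hσ
    obtain ⟨hτr, _⟩ := mem_nb.1 hτ
    unfold receivers Design.suppN at hτr
    rw [List.mem_toFinset, List.mem_map] at hτr
    obtain ⟨e', he', rfl⟩ := hτr
    have he'N : e' ∈ D.N := (List.mem_filter.1 he').1
    exact hdim e heS e' (hcov e' he'N ⟨e, heS, hw⟩) hw
  have key := h U hUne hUsub d hd hdimU
  -- `Σ_S m ≤ m(U)`
  have hSle : (S.map Prod.snd).sum ≤ massP D U := by
    rw [massP_eq_list]
    have e1 : S.map Prod.snd = S.map (fun e => if e.1 ∈ U then e.2 else 0) := by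
      apply List.map_congr_left
      intro e he
      by_cases hp : 0 < e.2
      · rw [if_pos (memU.2 ⟨e, he, hp, rfl⟩)]
      · have h0 : e.2 = 0 := by omega
        simp [h0]
    rw [e1]
    exact (hS.map _).sum_le_sum (fun _ _ => Nat.zero_le _)
  -- `n(Γ(U)) ≤ Σ_T n` (this is where `Nodup` enters: every N entry with cell in `Γ(U)` is a member of `T`, and members are not repeated)
  have hTge : massN D (nb D U) ≤ (T.map Prod.snd).sum := by
    rw [massN_eq_list]
    have hTnd : T.Nodup := hN.sublist hT
    have hzero : ∀ e ∈ D.N.toFinset, e ∉ T.toFinset → (fun e : Cell × ℕ => if e.1 ∈ nb D U then e.2 else 0) e = 0 := by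
      intro e heN heT
      show (if e.1 ∈ nb D U then e.2 else 0) = 0
      rw [if_neg]
      intro hmem
      apply heT
      rw [List.mem_toFinset] at heN ⊢
      obtain ⟨_, σ, hσ, hw⟩ := mem_nb.1 hmem
      obtain ⟨e₁, he₁S, _, rfl⟩ := memU.1 hσ
      exact hcov e heN ⟨e₁, he₁S, hw⟩
    have hsubT : T.toFinset ⊆ D.N.toFinset := by
      intro e he
      rw [List.mem_toFinset] at he ⊢
      exact hT.subset he
    calc (D.N.map fun e => if e.1 ∈ nb D U then e.2 else 0).sum
        = ∑ e ∈ D.N.toFinset, (if e.1 ∈ nb D U then e.2 else 0) := (List.sum_toFinset _ hN).symm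
      _ = ∑ e ∈ T.toFinset, (if e.1 ∈ nb D U then e.2 else 0) := (sum_subset hsubT hzero).symm
      _ = (T.map fun e => if e.1 ∈ nb D U then e.2 else 0).sum := List.sum_toFinset _ hTnd
      _ ≤ (T.map Prod.snd).sum := List.sum_le_sum (fun e _ => by
          show (if e.1 ∈ nb D U then e.2 else 0) ≤ e.2
          split_ifs <;> omega)
  omega

/-- **THEOREM Q1 on designs without duplicated N entries, from clause (c)** (LEMMA L + the translation). -/
theorem hallPlusLegUp_of_lawC (hN : D.N.Nodup) (h : LawC D) : HallPlusLegUp D :=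
  hallPlusLegUp_of_legIneq hN (legIneq_of_lawC h)

/-! ### A.7 Sanity of the specification's constants at the TIGHT clean instance `NUL4m1n2` (`n = 2 = m − c + 1 + g`) and at `NUL4m1n1` -/

theorem nul4_suppP : PatternedPorteous.NUL4m1n2.suppP = [xn4] := by decide
theorem nul4_suppN : PatternedPorteous.NUL4m1n2.suppN = [y3] := by decide

theorem rk_nul4_eq_zero (f : Fin 4) (hf : xn4 f = y3 f) : rk {xn4} {y3} f = 0 := by
  unfold rk
  rw [if_pos]
  intro σ hσ τ hτ _
  rw [mem_singleton] at hσ hτ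
  subst hσ; subst hτ
  exact hf

theorem rk_nul4_three_le : rk {xn4} {y3} 3 ≤ 1 := by
  have hn : ∀ σ ∈ ({xn4} : Finset Cell), ∀ τ ∈ ({y3} : Finset Cell), WeakLive σ τ → StepNull σ τ 3 := by
    intro σ hσ τ hτ _
    rw [mem_singleton] at hσ hτ
    subst hσ; subst hτ
    unfold StepNull
    decide
  have hp : ∀ σ ∈ ({xn4} : Finset Cell), ∀ τ ∈ ({y3} : Finset Cell), ∀ σ' ∈ ({xn4} : Finset Cell), ∀ τ' ∈ ({y3} : Finset Cell),
      WeakLive σ τ → WeakLive σ' τ' → StepPar σ τ σ' τ' 3 := by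
    intro σ hσ τ hτ σ' hσ' τ' hτ' _ _
    rw [mem_singleton] at hσ hτ hσ' hτ'
    subst hσ; subst hτ; subst hσ'; subst hτ'
    unfold StepPar
    decide
  unfold rk
  split_ifs with h0 h1
  · omega
  · omega
  · exact absurd ⟨hn, hp⟩ h1

theorem jrank_nul4_le : jrank {xn4} {y3} ≤ 1 := by
  have h0 := rk_nul4_eq_zero 0 (by decide)
  have h1 := rk_nul4_eq_zero 1 (by decide)
  have h2 := rk_nul4_eq_zero 2 (by decide)
  have h3 := rk_nul4_three_le
  unfold jrank
  omega

/-- the specification HOLDS at the tight PP-clean one-column null design `NUL4m1n2` (witness `𝔍 = {y3}`, one block, `g = 1`: `2 + 1 ≥ 1 + 1 + 1`). -/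
theorem lawC_NUL4m1n2 : LawC PatternedPorteous.NUL4m1n2 := by
  intro U hU hsub
  have hsend : senders PatternedPorteous.NUL4m1n2 = {xn4} := by
    unfold senders
    rw [nul4_suppP]
    simp
  rw [hsend] at hsub
  have hU' : U = {xn4} := by
    apply Subset.antisymm hsub
    intro σ hσ
    rw [mem_singleton] at hσ
    subst hσ
    obtain ⟨σ', hσ'⟩ := hU
    have h' := hsub hσ'
    rw [mem_singleton] at h'
    rw [h'] at hσ'
    exact hσ'
  subst hU'
  refine ⟨{y3}, ⟨y3, mem_singleton_self _⟩, ?_, fun _ => 0, ?_, ?_⟩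
  · intro τ hτ
    rw [mem_singleton] at hτ
    subst hτ
    rw [mem_nb]
    refine ⟨?_, xn4, mem_singleton_self _, ddup_weakLive⟩
    unfold receivers
    rw [nul4_suppN]
    simp
  · intro σ _ τ _ _
    rfl
  · have hseen : massP PatternedPorteous.NUL4m1n2 (seen {xn4} {y3}) ≤ massP PatternedPorteous.NUL4m1n2 {xn4} := by
      unfold massP
      exact sum_le_sum_of_subset (seen_subset _ _)
    have hP : massP PatternedPorteous.NUL4m1n2 {xn4} = 1 := by
      simp [massP, mP, PatternedPorteous.NUL4m1n2]
    have hN : massN PatternedPorteous.NUL4m1n2 {y3} = 2 := by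
      simp [massN, mN, PatternedPorteous.NUL4m1n2]
    have hc : (({y3} : Finset Cell).image fun _ : Cell => (0 : ℕ)).card = 1 := by simp
    have hj := jrank_nul4_le
    omega

/-- … and the typed leg row FAILS at `NUL4m1n1` (`1 + 1 ≤ 1`), so by the kernel chain the specification fails there too (PP-dirty, `nul4_m1n1`). -/
theorem not_hallPlusLegUp_NUL4m1n1 : ¬ HallPlusLegUp PatternedPorteous.NUL4m1n1 := by
  intro h
  have h1 := h [(xn4, 1)] (List.Sublist.refl _) (by decide) [(y3, 1)] (List.Sublist.refl _)
    (by intro cn hcn _; exact hcn) 1 (by norm_num)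
    (by
      intro cm hcm cn hcn _
      simp at hcm hcn
      subst hcm; subst hcn
      simp [ddup_pairDim])
  simp at h1

theorem not_lawC_NUL4m1n1 : ¬ LawC PatternedPorteous.NUL4m1n1 :=
  fun h => not_hallPlusLegUp_NUL4m1n1 (hallPlusLegUp_of_lawC (by decide) h)

/-! ### A.8 THE BRIDGE (checker soundness): negation's computable row `PortHallG.GClean` (`PortHallGRow.lean`) implies the specification `LawC` -/

section Bridge

open Summit.HodgeConjecture.HodgeConjecture.Cruxes.BlochSeedDiscOne.HallB136 (weakLiveB weakLiveB_of)
open Summit.HodgeConjecture.HodgeConjecture.Cruxes.BlochSeedDiscOne.PatternedPorteous (cellEqB cellEqB_iff)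
open Summit.HodgeConjecture.HodgeConjecture.Cruxes.BlochSeedDiscOne.PortHallG
  (StepVec stepVec propVec subl gammaU seenBy factorRank stepsAt gRank witnessB gCleanB GClean
   Vtx adjB vtxEqB grow reach connB numCompAux verts numComp)

/-! #### B.1 `subl` enumerates exactly the sub-lists -/

theorem mem_subl_of_sublist {α : Type} {l₁ l₂ : List α} (h : l₁.Sublist l₂) : l₁ ∈ subl l₂ := by
  induction h with
  | slnil => simp [subl]
  | cons a _ ih =>
    simp only [subl, List.mem_append]
    exact Or.inl ih
  | cons_cons a _ ih =>
    simp only [subl, List.mem_append, List.mem_map]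
    exact Or.inr ⟨_, ih, rfl⟩

theorem sublist_of_mem_subl {α : Type} {l₂ : List α} : ∀ {l₁ : List α}, l₁ ∈ subl l₂ → l₁.Sublist l₂ := by
  induction l₂ with
  | nil =>
    intro l₁ h
    simp only [subl, List.mem_singleton] at h
    subst h
    exact List.Sublist.slnil
  | cons a l ih =>
    intro l₁ h
    simp only [subl, List.mem_append, List.mem_map] at h
    rcases h with h | ⟨s, hs, rfl⟩
    · exact (ih h).cons a
    · exact (ih hs).cons_cons a

/-! #### B.2 What `gCleanB E = true` hands out: a non-empty witness `𝔍' ⊆ Γ(U')` with the witness inequality, for every non-empty sender sub-list `U'` -/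

theorem gClean_witness (hG : GClean D) {U' : List (Cell × ℕ)} (hU' : U'.Sublist (PortHallG.senders D)) (hne : U' ≠ []) :
    ∃ J' : List (Cell × ℕ), J'.Sublist (gammaU D U') ∧ J' ≠ [] ∧
      PortHallG.mass (seenBy U' J') + gRank U' J' + 1 ≤ PortHallG.mass J' + numComp (seenBy U' J') J' := by
  unfold GClean gCleanB at hG
  have h1 := List.all_eq_true.1 hG U' (mem_subl_of_sublist hU')
  rw [Bool.or_eq_true] at h1
  rcases h1 with h1 | h1
  · exact absurd (List.isEmpty_iff.1 h1) hne
  · obtain ⟨J', hJ', hw⟩ := List.any_eq_true.1 h1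
    unfold witnessB at hw
    rw [Bool.and_eq_true, decide_eq_true_eq] at hw
    refine ⟨J', sublist_of_mem_subl hJ', ?_, hw.2⟩
    intro hJ
    rw [hJ] at hw
    simp at hw

/-! #### B.3 Masses: entry-level (lists, negation) versus type-level (aggregated per cell, this file) -/

/-- `Σ` over a filtered list as an indicator sum over the whole list. -/
theorem mass_filter_eq (l : List (Cell × ℕ)) (p : Cell × ℕ → Bool) :
    PortHallG.mass (l.filter p) = (l.map fun e => if p e = true then e.2 else 0).sum := by
  induction l with
  | nil => simp [PortHallG.mass]
  | cons x l ih =>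
    unfold PortHallG.mass at ih ⊢
    by_cases hx : p x = true
    · rw [List.filter_cons_of_pos hx]
      simp [hx, ih]
    · rw [List.filter_cons_of_neg hx]
      simp [hx, ih]

/-- the mass of a sub-list of `D.N` is at most the aggregated `n`-mass of its set of cells. -/
theorem mass_le_massN {J' : List (Cell × ℕ)} (hJ' : J'.Sublist D.N) :
    PortHallG.mass J' ≤ massN D (J'.map Prod.fst).toFinset := by
  rw [massN_eq_list]
  have e1 : J'.map Prod.snd = J'.map (fun e => if e.1 ∈ (J'.map Prod.fst).toFinset then e.2 else 0) := by
    apply List.map_congr_left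
    intro e he
    rw [if_pos]
    rw [List.mem_toFinset, List.mem_map]
    exact ⟨e, he, rfl⟩
  unfold PortHallG.mass
  rw [e1]
  exact (hJ'.map _).sum_le_sum (fun _ _ => Nat.zero_le _)

/-- the aggregated `m`-mass of `U(𝔍)` is at most the mass of negation's `seenBy U' 𝔍'` when `U'` lifts ALL positive `P`-entries with cell in `U`. -/
theorem massP_seen_le (U : Finset Cell) (J' : List (Cell × ℕ)) :
    massP D (seen U (J'.map Prod.fst).toFinset) ≤
      PortHallG.mass (seenBy ((PortHallG.senders D).filter fun cm => decide (cm.1 ∈ U)) J') := by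
  rw [massP_eq_list]
  unfold seenBy PortHallG.senders
  simp only [List.filter_filter]
  rw [mass_filter_eq]
  apply List.sum_le_sum
  intro e _
  by_cases hs : e.1 ∈ seen U (J'.map Prod.fst).toFinset
  · rw [if_pos hs]
    rcases Nat.eq_zero_or_pos e.2 with h0 | hpos
    · rw [h0]
      exact Nat.zero_le _
    · rw [mem_seen] at hs
      obtain ⟨hU, τ, hτ, hw⟩ := hs
      rw [List.mem_toFinset, List.mem_map] at hτ
      obtain ⟨cn, hcn, rfl⟩ := hτ
      rw [if_pos]
      simp only [Bool.and_eq_true, decide_eq_true_eq, List.any_eq_true, hU, hpos, and_true]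
      exact ⟨cn, hcn, weakLiveB_of hw⟩
  · rw [if_neg hs]
    exact Nat.zero_le _

/-! #### B.4 The joint rank: `jrank U 𝔍 ≤ gRank U' 𝔍'` (type-level `r_f` versus negation's `factorRank` of the collected step kinds) -/

theorem mem_stepsAt {U' J' : List (Cell × ℕ)} {f : Fin 4} {v : StepVec} :
    v ∈ stepsAt U' J' f ↔ ∃ cm ∈ U', ∃ cn ∈ J', weakLiveB cm.1 cn.1 = true ∧ stepVec (cm.1 f) (cn.1 f) = some v := by
  unfold stepsAt
  induction U' with
  | nil => simp
  | cons x l ih =>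
    rw [List.foldr_cons, List.mem_append, ih]
    constructor
    · rintro (h | ⟨cm, hcm, cn, hcn, hw, hs⟩)
      · rw [List.mem_filterMap] at h
        obtain ⟨cn, hcn, hs⟩ := h
        rw [List.mem_filter] at hcn
        exact ⟨x, List.mem_cons.2 (Or.inl rfl), cn, hcn.1, hcn.2, hs⟩
      · exact ⟨cm, List.mem_cons_of_mem _ hcm, cn, hcn, hw, hs⟩
    · rintro ⟨cm, hcm, cn, hcn, hw, hs⟩
      rw [List.mem_cons] at hcm
      rcases hcm with rfl | hcm
      · left
        rw [List.mem_filterMap]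
        exact ⟨cn, List.mem_filter.2 ⟨hcn, hw⟩, hs⟩
      · right
        exact ⟨cm, hcm, cn, hcn, hw, hs⟩

theorem one_le_factorRank {l : List StepVec} (h : l ≠ []) : 1 ≤ factorRank l := by
  cases l with
  | nil => exact absurd rfl h
  | cons k rest =>
    simp only [factorRank]
    split_ifs <;> omega

theorem factorRank_eq_two_of_none_mem {l : List StepVec} (h : none ∈ l) : factorRank l = 2 := by
  cases l with
  | nil => simp at h
  | cons k rest =>
    simp only [factorRank]
    rw [if_pos]
    exact List.any_eq_true.2 ⟨none, h, rfl⟩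

/-- proportionality of NON-ZERO integer vectors is transitive (through a common non-zero `u`). -/
theorem propVec_trans {a x y a₁ x₁ y₁ a₂ x₂ y₂ : ℤ} (hu : (a, x, y) ≠ (0, 0, 0))
    (h1 : propVec (some (a, x, y)) (some (a₁, x₁, y₁)) = true) (h2 : propVec (some (a, x, y)) (some (a₂, x₂, y₂)) = true) :
    propVec (some (a₁, x₁, y₁)) (some (a₂, x₂, y₂)) = true := by
  simp only [propVec, Bool.and_eq_true, beq_iff_eq] at h1 h2 ⊢
  obtain ⟨⟨e1, e2⟩, e3⟩ := h1
  obtain ⟨⟨f1, f2⟩, f3⟩ := h2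
  -- `c · (goal)` vanishes for `c ∈ {a, x, y}` (or `a²`); one of them is non-zero
  have gx1 : x * (a₁ * x₂) = x * (a₂ * x₁) := by linear_combination (-x₂) * e1 + x₁ * f1
  have gy2 : y * (a₁ * y₂) = y * (a₂ * y₁) := by linear_combination (-y₂) * e2 + y₁ * f2
  have gx3 : x * (x₁ * y₂) = x * (x₂ * y₁) := by linear_combination x₁ * f3 - x₂ * e3
  have gy3 : y * (x₁ * y₂) = y * (x₂ * y₁) := by linear_combination (-y₂) * e3 + y₁ * f3
  by_cases ha : a = 0
  · subst ha
    by_cases hx : x = 0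
    · subst hx
      have hy : y ≠ 0 := by
        rintro rfl
        exact hu rfl
      have gy1 : y * (a₁ * x₂) = y * (a₂ * x₁) := by linear_combination (-x₂) * e2 + x₁ * f2
      exact ⟨⟨mul_left_cancel₀ hy gy1, mul_left_cancel₀ hy gy2⟩, mul_left_cancel₀ hy gy3⟩
    · have gx2 : x * (a₁ * y₂) = x * (a₂ * y₁) := by linear_combination (-y₂) * e1 + y₁ * f1
      exact ⟨⟨mul_left_cancel₀ hx gx1, mul_left_cancel₀ hx gx2⟩, mul_left_cancel₀ hx gx3⟩
  · have ga1 : a * (a₁ * x₂) = a * (a₂ * x₁) := by linear_combination a₁ * f1 - a₂ * e1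
    have ga2 : a * (a₁ * y₂) = a * (a₂ * y₁) := by linear_combination a₁ * f2 - a₂ * e2
    have ga3 : (a * a) * (x₁ * y₂) = (a * a) * (x₂ * y₁) := by
      linear_combination (a * y₂) * e1 + (a₁ * x) * f2 - (a * y₁) * f1 - (a₂ * x) * e2
    exact ⟨⟨mul_left_cancel₀ ha ga1, mul_left_cancel₀ ha ga2⟩, mul_left_cancel₀ (mul_ne_zero ha ha) ga3⟩

theorem propVec_refl (u : ℤ × ℤ × ℤ) : propVec (some u) (some u) = true := by
  obtain ⟨a, x, y⟩ := u
  simp [propVec]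

/-- if two null members of a list of step kinds are NOT proportional (and the null members are non-zero vectors), the factor rank is `2`. -/
theorem factorRank_eq_two_of_not_prop {l : List StepVec} {v w : ℤ × ℤ × ℤ} (hv : some v ∈ l) (hw : some w ∈ l)
    (hnz : ∀ u : ℤ × ℤ × ℤ, some u ∈ l → u ≠ (0, 0, 0)) (hnp : propVec (some v) (some w) = false) : factorRank l = 2 := by
  cases l with
  | nil => simp at hv
  | cons k rest =>
    simp only [factorRank]
    split_ifs with h1 h2
    · rfl
    · exfalso
      -- no ample member: the head is null
      obtain ⟨u₀, rfl⟩ : ∃ u₀, k = some u₀ := by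
        cases k with
        | none => exact absurd (List.any_eq_true.2 ⟨none, List.mem_cons.2 (Or.inl rfl), rfl⟩) h1
        | some u₀ => exact ⟨u₀, rfl⟩
      have hall : ∀ z ∈ some u₀ :: rest, propVec (some u₀) z = true := by
        intro z hz
        rw [List.mem_cons] at hz
        rcases hz with rfl | hz
        · exact propVec_refl u₀
        · exact List.all_eq_true.1 h2 z hz
      obtain ⟨a, x, y⟩ := u₀
      obtain ⟨a₁, x₁, y₁⟩ := v
      obtain ⟨a₂, x₂, y₂⟩ := w
      have := propVec_trans (hnz _ (List.mem_cons.2 (Or.inl rfl))) (hall _ hv) (hall _ hw)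
      rw [this] at hnp
      exact Bool.noConfusion hnp
    · rfl

/-- a recorded null step between DISTINCT letters is a non-zero vector. -/
theorem stepVec_some_some_ne_zero {ℓ ℓ' : Letter} {u : ℤ × ℤ × ℤ} (h : stepVec ℓ ℓ' = some (some u)) : u ≠ (0, 0, 0) := by
  unfold stepVec at h
  split_ifs at h with h1 h2
  · simp only [Option.some.injEq] at h
    rintro rfl
    apply h1
    cases ℓ
    cases ℓ'
    simp only [Prod.mk.injEq] at h
    simp only [Letter.mk.injEq]
    omega
  · simp at h

theorem propVec_iff_stepPar (σ τ σ' τ' : Cell) (f : Fin 4) :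
    propVec (some ((τ f).a - (σ f).a, (τ f).x - (σ f).x, (τ f).y - (σ f).y))
        (some ((τ' f).a - (σ' f).a, (τ' f).x - (σ' f).x, (τ' f).y - (σ' f).y)) = true ↔ StepPar σ τ σ' τ' f := by
  simp only [propVec, StepPar, Bool.and_eq_true, beq_iff_eq, and_assoc]

theorem stepNull_of_eq {σ τ : Cell} {f : Fin 4} (h : σ f = τ f) : StepNull σ τ f := by
  unfold StepNull
  rw [h]
  simp

theorem stepPar_of_eq_left {σ τ σ' τ' : Cell} {f : Fin 4} (h : σ f = τ f) : StepPar σ τ σ' τ' f := by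
  unfold StepPar
  rw [h]
  simp

theorem stepPar_of_eq_right {σ τ σ' τ' : Cell} {f : Fin 4} (h : σ' f = τ' f) : StepPar σ τ σ' τ' f := by
  unfold StepPar
  rw [h]
  simp

/-- `r_f(U, 𝔍) ≤ factorRank (stepsAt U' 𝔍' f)` whenever every type of `U` (resp. `𝔍`) is the cell of some entry of `U'` (resp. `𝔍'`) and conversely
every entry of `𝔍'` has its cell in `𝔍`. -/
theorem rk_le_factorRank {U J : Finset Cell} {U' J' : List (Cell × ℕ)} (f : Fin 4)
    (hU : ∀ σ ∈ U, ∃ cm ∈ U', cm.1 = σ) (hJ : ∀ τ ∈ J, ∃ cn ∈ J', cn.1 = τ) :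
    rk U J f ≤ factorRank (stepsAt U' J' f) := by
  -- every live pair of `U × 𝔍` with a non-zero step on `f` records its step kind in `stepsAt U' 𝔍' f`
  have key : ∀ σ ∈ U, ∀ τ ∈ J, WeakLive σ τ → σ f ≠ τ f → stepVec (σ f) (τ f) ≠ none ∧
      ∀ v, stepVec (σ f) (τ f) = some v → v ∈ stepsAt U' J' f := by
    intro σ hσ τ hτ hw hne
    obtain ⟨cm, hcm, rfl⟩ := hU σ hσ
    obtain ⟨cn, hcn, rfl⟩ := hJ _ hτ
    refine ⟨?_, fun v hv => mem_stepsAt.2 ⟨cm, hcm, cn, hcn, weakLiveB_of hw, hv⟩⟩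
    unfold stepVec
    rw [if_neg hne]
    split_ifs <;> exact Option.some_ne_none _
  have hnz : ∀ u : ℤ × ℤ × ℤ, some u ∈ stepsAt U' J' f → u ≠ (0, 0, 0) := by
    intro u hu
    obtain ⟨cm, _, cn, _, _, hs⟩ := mem_stepsAt.1 hu
    exact stepVec_some_some_ne_zero hs
  -- an ample (non-null) live step forces rank 2
  have ample : ∀ σ ∈ U, ∀ τ ∈ J, WeakLive σ τ → ¬ StepNull σ τ f → factorRank (stepsAt U' J' f) = 2 := by
    intro σ hσ τ hτ hw hnn
    have hne : σ f ≠ τ f := fun h => hnn (stepNull_of_eq h)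
    have hsv : stepVec (σ f) (τ f) = some none := by
      unfold stepVec
      rw [if_neg hne, if_neg]
      exact hnn
    exact factorRank_eq_two_of_none_mem ((key σ hσ τ hτ hw hne).2 none hsv)
  unfold rk
  split_ifs with h0 h1
  · exact Nat.zero_le _
  · push Not at h0
    obtain ⟨σ, hσ, τ, hτ, hw, hne⟩ := h0
    obtain ⟨hsome, hmem⟩ := key σ hσ τ hτ hw hne
    obtain ⟨v, hv⟩ := Option.ne_none_iff_exists'.1 hsome
    exact one_le_factorRank (List.ne_nil_of_mem (hmem v hv))
  · rw [not_and_or] at h1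
    rcases h1 with h1 | h1
    · push Not at h1
      obtain ⟨σ, hσ, τ, hτ, hw, hnn⟩ := h1
      rw [ample σ hσ τ hτ hw hnn]
    · push Not at h1
      obtain ⟨σ, hσ, τ, hτ, σ', hσ', τ', hτ', hw, hw', hnp⟩ := h1
      by_cases hn : StepNull σ τ f
      · by_cases hn' : StepNull σ' τ' f
        · have hne : σ f ≠ τ f := fun h => hnp (stepPar_of_eq_left h)
          have hne' : σ' f ≠ τ' f := fun h => hnp (stepPar_of_eq_right h)
          have hsv : stepVec (σ f) (τ f) = some (some ((τ f).a - (σ f).a, (τ f).x - (σ f).x, (τ f).y - (σ f).y)) := by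
            unfold stepVec
            rw [if_neg hne, if_pos]
            exact hn
          have hsv' : stepVec (σ' f) (τ' f) = some (some ((τ' f).a - (σ' f).a, (τ' f).x - (σ' f).x, (τ' f).y - (σ' f).y)) := by
            unfold stepVec
            rw [if_neg hne', if_pos]
            exact hn'
          have hm := (key σ hσ τ hτ hw hne).2 _ hsv
          have hm' := (key σ' hσ' τ' hτ' hw' hne').2 _ hsv'
          have hfalse : propVec (some ((τ f).a - (σ f).a, (τ f).x - (σ f).x, (τ f).y - (σ f).y))
              (some ((τ' f).a - (σ' f).a, (τ' f).x - (σ' f).x, (τ' f).y - (σ' f).y)) = false := by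
            rw [Bool.eq_false_iff]
            intro h
            exact hnp ((propVec_iff_stepPar σ τ σ' τ' f).1 h)
          rw [factorRank_eq_two_of_not_prop hm hm' hnz hfalse]
        · rw [ample σ' hσ' τ' hτ' hw' hn']
      · rw [ample σ hσ τ hτ hw hn]

theorem jrank_le_gRank {U J : Finset Cell} {U' J' : List (Cell × ℕ)}
    (hU : ∀ σ ∈ U, ∃ cm ∈ U', cm.1 = σ) (hJ : ∀ τ ∈ J, ∃ cn ∈ J', cn.1 = τ) : jrank U J ≤ gRank U' J' := by
  have h0 := rk_le_factorRank (U := U) (J := J) (U' := U') (J' := J') 0 hU hJ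
  have h1 := rk_le_factorRank (U := U) (J := J) (U' := U') (J' := J') 1 hU hJ
  have h2 := rk_le_factorRank (U := U) (J := J) (U' := U') (J' := J') 2 hU hJ
  have h3 := rk_le_factorRank (U := U) (J := J) (U' := U') (J' := J') 3 hU hJ
  unfold jrank gRank
  omega

/-! #### B.5 The components: negation's BFS count `numComp` is attained by a cross-free labelling (checker soundness of the component count, KERNEL) -/

/-! The live bipartite graph on `U(𝔍') ⊔ 𝔍'` admits a labelling of CELLS, constant along weakly-live arrows, with at least `numComp (U(𝔍')) 𝔍'`
labels met on the cells of `𝔍'` — the BFS component labelling (first-seed index) attains it.  Finite graph theory on negation's `grow ∕ reach ∕ connB ∕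
numCompAux`: the fuelled front `reach V |V| [v]` is closed under adjacency (`front_closed`: a strictly increasing chain of fronts inside `V` has length
`≤ |V|`), reachability is then reflexive ∕ transitive ∕ symmetric (`rch_meet`), adjacent vertices have the same first seed (`labv_eq_of_adj`), and two
vertices with the same first seed are connected (`connB_of_labv_eq`), so `numCompAux` counts at most the labels (`numCompAux_le`).  KERNEL, 0 sorry. -/

section BFS

open scoped Classical

variable (V : List Vtx)

/-! ##### the fuelled BFS `reach` as an iterate of `grow`, and its set semantics -/

theorem reach_eq_iterate (n : ℕ) (S : List Vtx) : reach V n S = (grow V)^[n] S := by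
  induction n generalizing S with
  | zero => rfl
  | succ n ih =>
    rw [Function.iterate_succ_apply]
    exact ih (grow V S)

theorem mem_grow {S : List Vtx} {w : Vtx} : w ∈ grow V S ↔ w ∈ S ∨ (w ∈ V ∧ ∃ u ∈ S, adjB u w = true) := by
  unfold grow
  rw [List.mem_append, List.mem_filter, List.any_eq_true]

theorem mem_iterate_of_mem {S : List Vtx} {x : Vtx} (hx : x ∈ S) (n : ℕ) : x ∈ (grow V)^[n] S := by
  induction n generalizing S with
  | zero => exact hx
  | succ n ih =>
    rw [Function.iterate_succ_apply]
    exact ih ((mem_grow V).2 (Or.inl hx))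

/-- one BFS step on SETS. -/
noncomputable def gset (T : Finset Vtx) : Finset Vtx := T ∪ V.toFinset.filter fun w => ∃ u ∈ T, adjB u w = true

theorem toFinset_grow (S : List Vtx) : (grow V S).toFinset = gset V S.toFinset := by
  ext w
  unfold gset
  rw [List.mem_toFinset, mem_grow, Finset.mem_union, Finset.mem_filter, List.mem_toFinset, List.mem_toFinset]
  simp only [List.mem_toFinset]

/-- the `k`-th BFS front from the seed `v`, as a set. -/
noncomputable def front (v : Vtx) (k : ℕ) : Finset Vtx := ((grow V)^[k] [v]).toFinset

theorem front_zero (v : Vtx) : front V v 0 = {v} := by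
  unfold front
  simp

theorem front_succ (v : Vtx) (k : ℕ) : front V v (k + 1) = gset V (front V v k) := by
  unfold front
  rw [Function.iterate_succ_apply', toFinset_grow]

theorem front_mono (v : Vtx) (k : ℕ) : front V v k ⊆ front V v (k + 1) := by
  rw [front_succ]
  unfold gset
  exact Finset.subset_union_left

theorem front_subset (v : Vtx) (hv : v ∈ V) (k : ℕ) : front V v k ⊆ V.toFinset := by
  induction k with
  | zero =>
    rw [front_zero, Finset.singleton_subset_iff, List.mem_toFinset]
    exact hv
  | succ k ih =>
    rw [front_succ]
    unfold gset
    exact Finset.union_subset ih (Finset.filter_subset _ _)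

theorem front_stable (v : Vtx) {j : ℕ} (h : front V v j = front V v (j + 1)) : ∀ i, j ≤ i → front V v i = front V v j := by
  intro i hi
  induction i, hi using Nat.le_induction with
  | base => rfl
  | succ n hn ih => rw [front_succ, ih, ← front_succ, ← h]

theorem front_card (v : Vtx) (k : ℕ) (h : ∀ j < k, front V v j ≠ front V v (j + 1)) : k + 1 ≤ (front V v k).card := by
  induction k with
  | zero => rw [front_zero, Finset.card_singleton]
  | succ k ih =>
    have hk := ih (fun j hj => h j (by omega))
    have hss : front V v k ⊂ front V v (k + 1) := Finset.ssubset_iff_subset_ne.2 ⟨front_mono V v k, h k (by omega)⟩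
    have := Finset.card_lt_card hss
    omega

/-- FUEL SUFFICES: after `|V|` steps the front is closed under one more step. -/
theorem front_closed (v : Vtx) (hv : v ∈ V) : front V v (V.length + 1) = front V v V.length := by
  by_contra hne
  have hall : ∀ j < V.length + 1, front V v j ≠ front V v (j + 1) := by
    intro j hj heq
    apply hne
    rw [front_stable V v heq (V.length + 1) (by omega), front_stable V v heq V.length (by omega)]
  have h1 := front_card V v (V.length + 1) hall
  have h2 := (Finset.card_le_card (front_subset V v hv (V.length + 1))).trans (List.toFinset_card_le V)
  omega

/-- reachability within the fuel. -/
def Rch (x u : Vtx) : Prop := u ∈ reach V V.length [x]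

theorem rch_iff_front {x u : Vtx} : Rch V x u ↔ u ∈ front V x V.length := by
  unfold Rch front
  rw [reach_eq_iterate, List.mem_toFinset]

theorem rch_refl (x : Vtx) : Rch V x x := by
  unfold Rch
  rw [reach_eq_iterate]
  exact mem_iterate_of_mem V (List.mem_cons.2 (Or.inl rfl)) _

/-- CLOSURE under adjacency (the content of `front_closed`). -/
theorem rch_step {x u w : Vtx} (hx : x ∈ V) (hu : Rch V x u) (hw : w ∈ V) (hadj : adjB u w = true) : Rch V x w := by
  rw [rch_iff_front] at hu ⊢
  rw [← front_closed V x hx, front_succ]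
  unfold gset
  rw [Finset.mem_union, Finset.mem_filter, List.mem_toFinset]
  exact Or.inr ⟨hw, u, hu, hadj⟩

theorem mem_of_rch {x u : Vtx} (hx : x ∈ V) (hu : Rch V x u) : u ∈ V := by
  rw [rch_iff_front] at hu
  exact List.mem_toFinset.1 (front_subset V x hx _ hu)

/-- MINIMALITY: a property closed under adjacency that holds on the seed list holds on everything reached. -/
theorem reach_induction {C : Vtx → Prop} (hC : ∀ u, C u → ∀ w ∈ V, adjB u w = true → C w) :
    ∀ (n : ℕ) (S : List Vtx), (∀ u ∈ S, C u) → ∀ u ∈ (grow V)^[n] S, C u := by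
  intro n
  induction n with
  | zero => intro S hS u hu; exact hS u hu
  | succ n ih =>
    intro S hS u hu
    rw [Function.iterate_succ_apply] at hu
    refine ih (grow V S) ?_ u hu
    intro w hw
    rcases (mem_grow V).1 hw with hw | ⟨hwV, s, hs, hadj⟩
    · exact hS w hw
    · exact hC s (hS s hs) w hwV hadj

theorem adjB_symm {u w : Vtx} (h : adjB u w = true) : adjB w u = true := by
  obtain ⟨b, c⟩ := u
  obtain ⟨b', c'⟩ := w
  cases b <;> cases b' <;> simp_all [adjB]

theorem rch_trans {x y z : Vtx} (hx : x ∈ V) (hxy : Rch V x y) (hyz : Rch V y z) : Rch V x z := by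
  unfold Rch at hyz
  rw [reach_eq_iterate] at hyz
  refine reach_induction V (C := fun u => Rch V x u) ?_ V.length [y] ?_ z hyz
  · intro u hu w hw hadj
    exact rch_step V hx hu hw hadj
  · intro u hu
    rw [List.mem_singleton] at hu
    subst hu
    exact hxy

theorem rch_symm {x w : Vtx} (hx : x ∈ V) (h : Rch V x w) : Rch V w x := by
  unfold Rch at h
  rw [reach_eq_iterate] at h
  have key := reach_induction V (C := fun u => u ∈ V ∧ Rch V u x) ?_ V.length [x] ?_ w h
  · exact key.2
  · rintro u ⟨huV, hux⟩ w' hw' hadj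
    refine ⟨hw', ?_⟩
    have h1 : Rch V w' u := rch_step V hw' (rch_refl V w') huV (adjB_symm hadj)
    exact rch_trans V hw' h1 hux
  · intro u hu
    rw [List.mem_singleton] at hu
    subst hu
    exact ⟨hx, rch_refl V u⟩

/-- two vertices reached from a common seed reach each other. -/
theorem rch_meet {x v w : Vtx} (hx : x ∈ V) (hxv : Rch V x v) (hxw : Rch V x w) : Rch V w v :=
  rch_trans V (mem_of_rch V hx hxw) (rch_symm V hx hxw) hxv

/-! ##### `connB` and the first-seed label -/

theorem vtxEqB_iff (u w : Vtx) : vtxEqB u w = true ↔ u = w := by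
  obtain ⟨b, c⟩ := u
  obtain ⟨b', c'⟩ := w
  simp [vtxEqB, cellEqB_iff, Prod.ext_iff]

theorem connB_iff {x u : Vtx} : connB V x u = true ↔ Rch V x u := by
  unfold connB Rch
  rw [List.any_eq_true]
  constructor
  · rintro ⟨u', hu', he⟩
    rw [vtxEqB_iff] at he
    subst he
    exact hu'
  · intro h
    exact ⟨u, h, (vtxEqB_iff u u).2 rfl⟩

/-- the label of a vertex: the index in `V` of the first vertex it is connected to. -/
def labv (u : Vtx) : ℕ := V.findIdx fun x => connB V x u

theorem findIdx_congr {p q : Vtx → Bool} {l : List Vtx} (h : ∀ x ∈ l, p x = q x) : l.findIdx p = l.findIdx q := by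
  induction l with
  | nil => simp
  | cons x l ih =>
    rw [List.findIdx_cons, List.findIdx_cons, h x (List.mem_cons.2 (Or.inl rfl)),
      ih (fun y hy => h y (List.mem_cons_of_mem _ hy))]

/-- adjacent vertices carry the same label (so the labelling is cross-free). -/
theorem labv_eq_of_adj {u w : Vtx} (hu : u ∈ V) (hw : w ∈ V) (hadj : adjB u w = true) : labv V u = labv V w := by
  unfold labv
  apply findIdx_congr
  intro x hx
  rw [Bool.eq_iff_iff, connB_iff, connB_iff]
  exact ⟨fun h => rch_step V hx h hw hadj, fun h => rch_step V hx h hu (adjB_symm hadj)⟩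

theorem labv_lt {u : Vtx} (hu : u ∈ V) : labv V u < V.length :=
  List.findIdx_lt_length_of_exists ⟨u, hu, (connB_iff V).2 (rch_refl V u)⟩

/-- two vertices with the same label are connected. -/
theorem connB_of_labv_eq {v w : Vtx} (hv : v ∈ V) (hw : w ∈ V) (h : labv V v = labv V w) : connB V w v = true := by
  have hlt : labv V v < V.length := labv_lt V hv
  have hlt' : labv V w < V.length := labv_lt V hw
  have e1 : connB V (V[labv V v]'hlt) v = true := List.findIdx_getElem (w := hlt)
  have e2 : connB V (V[labv V w]'hlt') w = true := List.findIdx_getElem (w := hlt')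
  have e3 : V[labv V w]'hlt' = V[labv V v]'hlt := by simp [h]
  rw [e3] at e2
  rw [connB_iff] at e1 e2 ⊢
  exact rch_meet V (List.getElem_mem hlt) e1 e2

/-! ##### the count: `numCompAux` never exceeds the number of labels -/

theorem numCompAux_le (pre rest : List Vtx) (hpre : ∀ x ∈ pre, x ∈ V) (hrest : ∀ x ∈ rest, x ∈ V) :
    numCompAux V pre rest + (pre.toFinset.image (labv V)).card ≤ ((pre ++ rest).toFinset.image (labv V)).card := by
  induction rest generalizing pre with
  | nil => simp [numCompAux]
  | cons v rest ih =>
    have hv : v ∈ V := hrest v (List.mem_cons.2 (Or.inl rfl))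
    have hrest' : ∀ x ∈ rest, x ∈ V := fun x hx => hrest x (List.mem_cons_of_mem _ hx)
    have hpre' : ∀ x ∈ v :: pre, x ∈ V := by
      intro x hx
      rw [List.mem_cons] at hx
      rcases hx with rfl | hx
      · exact hv
      · exact hpre x hx
    have ih' := ih (v :: pre) hpre' hrest'
    have hperm : ((v :: pre) ++ rest).toFinset = (pre ++ v :: rest).toFinset := by
      ext x
      simp only [List.mem_toFinset, List.mem_append, List.mem_cons]
      tauto
    rw [hperm] at ih'
    have hins : (v :: pre).toFinset.image (labv V) = insert (labv V v) (pre.toFinset.image (labv V)) := by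
      rw [List.toFinset_cons, Finset.image_insert]
    rw [hins] at ih'
    simp only [numCompAux]
    split_ifs with hc
    · have := Finset.card_le_card (Finset.subset_insert (labv V v) (pre.toFinset.image (labv V)))
      omega
    · have hnot : labv V v ∉ pre.toFinset.image (labv V) := by
        intro hmem
        rw [Finset.mem_image] at hmem
        obtain ⟨w, hw, hlab⟩ := hmem
        rw [List.mem_toFinset] at hw
        apply hc
        exact List.any_eq_true.2 ⟨w, hw, connB_of_labv_eq V hv (hpre w hw) hlab.symm⟩
      rw [Finset.card_insert_of_notMem hnot] at ih'
      omega

theorem numCompAux_nil_le (hV : ∀ x ∈ V, x ∈ V) : numCompAux V [] V ≤ (V.toFinset.image (labv V)).card := by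
  have := numCompAux_le V [] V (fun _ h => by simp at h) hV
  simpa using this

end BFS

/-! ##### B.5 proper -/

theorem numComp_le_card_labels (UJ J' : List (Cell × ℕ)) (hUJ : ∀ cm ∈ UJ, ∃ cn ∈ J', weakLiveB cm.1 cn.1 = true) :
    ∃ κ : Cell → ℕ, (∀ cm ∈ UJ, ∀ cn ∈ J', weakLiveB cm.1 cn.1 = true → κ cm.1 = κ cn.1) ∧
      numComp UJ J' ≤ ((J'.map Prod.fst).toFinset.image κ).card := by
  classical
  set V : List Vtx := verts UJ J' with hVdef
  have memS : ∀ cm ∈ UJ, ((false, cm.1) : Vtx) ∈ V := by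
    intro cm hcm
    rw [hVdef]
    unfold verts
    rw [List.mem_append, List.mem_map]
    exact Or.inl ⟨cm, hcm, rfl⟩
  have memR : ∀ cn ∈ J', ((true, cn.1) : Vtx) ∈ V := by
    intro cn hcn
    rw [hVdef]
    unfold verts
    rw [List.mem_append, List.mem_map, List.mem_map]
    exact Or.inr ⟨cn, hcn, rfl⟩
  have adjSR : ∀ σ τ : Cell, adjB (false, σ) (true, τ) = weakLiveB σ τ := fun _ _ => rfl
  have adjRS : ∀ σ τ : Cell, adjB (true, τ) (false, σ) = weakLiveB σ τ := fun _ _ => rfl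
  have wrefl : ∀ τ : Cell, weakLiveB τ τ = true := fun τ => weakLiveB_of (fun _ => Or.inl rfl)
  let κ : Cell → ℕ := fun c => if ((false, c) : Vtx) ∈ V then labv V (false, c) else labv V (true, c)
  -- on receiver cells the label is the receiver-vertex label
  have κR : ∀ cn ∈ J', κ cn.1 = labv V (true, cn.1) := by
    intro cn hcn
    show (if ((false, cn.1) : Vtx) ∈ V then labv V (false, cn.1) else labv V (true, cn.1)) = _
    split_ifs with h
    · exact (labv_eq_of_adj V (memR cn hcn) h (by rw [adjRS]; exact wrefl _)).symm
    · rfl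
  have κS : ∀ cm ∈ UJ, κ cm.1 = labv V (false, cm.1) := by
    intro cm hcm
    show (if ((false, cm.1) : Vtx) ∈ V then labv V (false, cm.1) else labv V (true, cm.1)) = _
    rw [if_pos (memS cm hcm)]
  refine ⟨κ, ?_, ?_⟩
  · intro cm hcm cn hcn hw
    rw [κS cm hcm, κR cn hcn]
    exact labv_eq_of_adj V (memS cm hcm) (memR cn hcn) (by rw [adjSR]; exact hw)
  · -- numComp ≤ #labels on vertices ≤ #labels on receiver cells
    have hV : ∀ x ∈ V, x ∈ V := fun _ h => h
    have h1 : numComp UJ J' ≤ (V.toFinset.image (labv V)).card := by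
      unfold numComp
      rw [← hVdef]
      exact numCompAux_nil_le V hV
    refine h1.trans (Finset.card_le_card ?_)
    intro i hi
    rw [Finset.mem_image] at hi
    obtain ⟨u, hu, rfl⟩ := hi
    rw [List.mem_toFinset] at hu
    have hu' := hu
    rw [hVdef] at hu'
    unfold verts at hu'
    rw [List.mem_append, List.mem_map, List.mem_map] at hu'
    rw [Finset.mem_image]
    rcases hu' with ⟨cm, hcm, rfl⟩ | ⟨cn, hcn, rfl⟩
    · obtain ⟨cn, hcn, hw⟩ := hUJ cm hcm
      refine ⟨cn.1, ?_, ?_⟩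
      · rw [List.mem_toFinset, List.mem_map]
        exact ⟨cn, hcn, rfl⟩
      · rw [κR cn hcn]
        exact (labv_eq_of_adj V (memS cm hcm) (memR cn hcn) (by rw [adjSR]; exact hw)).symm
    · refine ⟨cn.1, ?_, κR cn hcn⟩
      rw [List.mem_toFinset, List.mem_map]
      exact ⟨cn, hcn, rfl⟩


/-! #### B.6 The bridge -/

/-- **CHECKER SOUNDNESS**: negation's exact row `GClean E` (`gCleanB E = true`) implies the Prop-level clause (c) `LawC E`.  Given a non-empty set `U`
of sender types, lift it to the sub-list `U'` of ALL positive `P`-entries with cell in `U`; `gCleanB` hands a witness `𝔍' ⊆ Γ(U')`; its set of cells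
`𝔍` and the component labelling of B.5 satisfy (c): masses compare by B.3, the joint rank by B.4, the component count by B.5. -/
theorem lawC_of_gClean (hG : GClean D) : LawC D := by
  intro U hUne hUsub
  set U' : List (Cell × ℕ) := (PortHallG.senders D).filter fun cm => decide (cm.1 ∈ U) with hU'def
  have hU'sub : U'.Sublist (PortHallG.senders D) := List.filter_sublist
  have hlift : ∀ σ ∈ U, ∃ cm ∈ U', cm.1 = σ := by
    intro σ hσ
    have hs : σ ∈ D.suppP := List.mem_toFinset.1 (hUsub hσ)
    obtain ⟨m, hm, hpos⟩ := (mem_suppP_iff D σ).1 hs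
    refine ⟨(σ, m), ?_, rfl⟩
    rw [hU'def, List.mem_filter]
    refine ⟨?_, by simpa using hσ⟩
    unfold PortHallG.senders
    rw [List.mem_filter]
    exact ⟨hm, by simpa using hpos⟩
  have hU'ne : U' ≠ [] := by
    obtain ⟨σ, hσ⟩ := hUne
    obtain ⟨cm, hcm, _⟩ := hlift σ hσ
    exact List.ne_nil_of_mem hcm
  obtain ⟨J', hJ'sub, hJ'ne, hw⟩ := gClean_witness hG hU'sub hU'ne
  have hgam : (gammaU D U').Sublist (PortHallG.receivers D) := by
    unfold gammaU
    exact List.filter_sublist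
  have hrec : (PortHallG.receivers D).Sublist D.N := by
    unfold PortHallG.receivers
    exact List.filter_sublist
  have hJ'N : J'.Sublist D.N := hJ'sub.trans (hgam.trans hrec)
  set J : Finset Cell := (J'.map Prod.fst).toFinset with hJdef
  have hproj : ∀ τ ∈ J, ∃ cn ∈ J', cn.1 = τ := by
    intro τ hτ
    rw [hJdef, List.mem_toFinset, List.mem_map] at hτ
    exact hτ
  have hUJ : ∀ cm ∈ seenBy U' J', ∃ cn ∈ J', weakLiveB cm.1 cn.1 = true := by
    intro cm hcm
    unfold seenBy at hcm
    rw [List.mem_filter] at hcm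
    exact List.any_eq_true.1 hcm.2
  obtain ⟨κ, hκ, hcnt⟩ := numComp_le_card_labels (seenBy U' J') J' hUJ
  refine ⟨J, ?_, ?_, κ, ?_, ?_⟩
  · obtain ⟨cn, hcn⟩ := List.exists_mem_of_ne_nil J' hJ'ne
    refine ⟨cn.1, ?_⟩
    rw [hJdef, List.mem_toFinset, List.mem_map]
    exact ⟨cn, hcn, rfl⟩
  · intro τ hτ
    obtain ⟨cn, hcn, rfl⟩ := hproj τ hτ
    have hg := hJ'sub.subset hcn
    unfold gammaU at hg
    rw [List.mem_filter] at hg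
    obtain ⟨hr, hany⟩ := hg
    unfold PortHallG.receivers at hr
    rw [List.mem_filter] at hr
    obtain ⟨cm, hcm, hwB⟩ := List.any_eq_true.1 hany
    rw [mem_nb]
    refine ⟨?_, cm.1, ?_, weakLive_of_weakLiveB hwB⟩
    · unfold receivers
      rw [List.mem_toFinset, mem_suppN_iff]
      exact ⟨cn.2, hr.1, by simpa using hr.2⟩
    · have h2 := (List.mem_filter.1 hcm).2
      simpa using h2
  · intro σ hσ τ hτ hwl
    obtain ⟨cm, hcm, rfl⟩ := hlift σ hσ
    obtain ⟨cn, hcn, rfl⟩ := hproj _ hτ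
    apply hκ cm ?_ cn hcn (weakLiveB_of hwl)
    unfold seenBy
    rw [List.mem_filter]
    exact ⟨hcm, List.any_eq_true.2 ⟨cn, hcn, weakLiveB_of hwl⟩⟩
  · have h1 := massP_seen_le (D := D) U J'
    rw [← hU'def, ← hJdef] at h1
    have h2 : jrank U J ≤ gRank U' J' := jrank_le_gRank hlift hproj
    have h3 := mass_le_massN (D := D) hJ'N
    rw [← hJdef] at h3
    rw [← hJdef] at hcnt
    omega

/-- the bridge composed with LEMMA L and the translation: negation's GUARDED `LemmaL` (v2), modulo the named step B.5. -/
theorem hallPlusLegUp_of_gClean (hN : D.N.Nodup) (hG : GClean D) : HallPlusLegUp D :=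
  hallPlusLegUp_of_lawC hN (lawC_of_gClean hG)

end Bridge

/-- AUDIT: nothing on the path of 18881 is decided in Part A. -/
theorem audit_nothing_decided_partA : True := trivial

end Clauses

end Summit.HodgeConjecture.HodgeConjecture.Cruxes.BlochSeedDiscOne.Q1Kernel

/-! ## Part B — the statements of record in `SeedChecker.SplitBlock`: `not_theoremQ1`, `TheoremQ1N`, the named steps, the composition, the consumers -/

open CategoryTheory AlgebraicGeometry
open Literature.AlgebraicGeometry Literature.AlgebraicGeometry.Motives Literature.AlgebraicGeometry.HodgeTheory
open Literature.AlgebraicTopology.SingularHomology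

namespace Summit.HodgeConjecture.HodgeConjecture.Cruxes.BlochSeedDiscOne.SeedChecker

open Summit.HodgeConjecture.HodgeConjecture.Cruxes.BlochSeedDiscOne.Anchor
open Summit.Ventures.HSemireg Summit.Ventures.HSemireg.Pad4Tower

namespace SplitBlock

section Q1Kernel

/-- **`TheoremQ1` AS TYPED IS FALSE** (the duplicate-entry design `Q1Kernel.Ddup` = negation's `PortHallG.Ddup` of v2; §0 of the header). -/
theorem not_theoremQ1 : ¬ TheoremQ1 := fun h => Q1Kernel.ddup_not_hallPlusLegUp (h _ Q1Kernel.ddup_ppClean)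

/-- **THEOREM Q1, REPAIRED** (the memo's theorem at the list level): on designs whose N-list has no duplicated entry (PAIR-level guard — every shadow of
record, `shadow_N_nodup`) LAW PP for the weak arrow relation implies the leg-surplus row.  TYPED; closed iff the two named steps below are. -/
def TheoremQ1N : Prop :=
  ∀ D : DepthBoundA4.Design, D.N.Nodup → PatternedPorteous.PPClean PatternedPorteous.weakB D → PortHallLeg.HallPlusLegUp D

/-- **THE NAMED `sorry` OF RECORD — THEOREM G, forward direction (a) ⟹ (c), UNGUARDED** (R19.923 (2); memo v1.6 961a4a2f27abe983 = v1.7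
6a03cfefbcd70900 §4quinquies; officer READ #10 (f) PASS ×2): LAW PP implies negation's exact row `GClean` (`PortHallGRow.lean`).  Pen proof GEOMETRIC
((a) ⟹ (b): induction on `|T|`, regular display sections, Whitney ∕ [Fulton, Intersection Theory, Thm 14.4(a), Prop. 14.1(b)]; (b) ⟹ (c): the stratum
criterion via Kleiman–Bertini on `∏ ℙ_τ`, the algebraic polymatroid of `Ȳ` and [CCLMZ20 Thm A]); no kernel-internal (letter-ring) proof in print — fill
judged > 2 sessions (R19.912 fallback).  No guard needed: both sides are blind to the `N.Nodup` defect (`PortHallG.ddup_gClean`). -/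
theorem gClean_of_ppClean (D : DepthBoundA4.Design) (h : PatternedPorteous.PPClean PatternedPorteous.weakB D) : PortHallG.GClean D := by
  sorry

/-- **LEMMA L on negation's row, GUARDED** — the statement `PortHallG.LemmaL` of `PortHallGRow.lean` v2 d16bfab8432ec171 (BUILT 19:44:31Z), BY NAME: KERNEL
through the bridge `Q1Kernel.lawC_of_gClean` (checker soundness) + `Q1Kernel.legIneq_of_lawC` (LEMMA L proper: pigeonhole + strong induction, 0 sorry)
+ `Q1Kernel.hallPlusLegUp_of_legIneq` (translation, 0 sorry); its only non-kernel input is the named step `Q1Kernel.numComp_le_card_labels` (B.5). -/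
theorem lemmaL : PortHallG.LemmaL :=
  fun _ hN hG => Q1Kernel.hallPlusLegUp_of_gClean hN hG

/-- the same, with the guarded statement spelled out (identity: `PortHallG.LemmaL` v2 unfolds to it by `rfl`). -/
theorem lemmaL_explicit : ∀ E : DepthBoundA4.Design, E.N.Nodup → PortHallG.GClean E → PortHallLeg.HallPlusLegUp E := lemmaL

/-- R19.928 (2)'s corollary name: THEOREM G forward in negation's vocabulary gives STEP C in the Prop vocabulary (the bridge, pointwise). -/
theorem stepC_of_gClean_of_ppClean (hG : ∀ D : DepthBoundA4.Design, PatternedPorteous.PPClean PatternedPorteous.weakB D → PortHallG.GClean D) :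
    ∀ D : DepthBoundA4.Design, PatternedPorteous.PPClean PatternedPorteous.weakB D → Q1Kernel.LawC D :=
  fun D h => Q1Kernel.lawC_of_gClean (hG D h)

/-- STEP C in the Prop-level vocabulary (derived: THEOREM G forward + the bridge; no `sorry` of its own). -/
theorem stepC_of_ppClean (D : DepthBoundA4.Design) (h : PatternedPorteous.PPClean PatternedPorteous.weakB D) : Q1Kernel.LawC D :=
  Q1Kernel.lawC_of_gClean (gClean_of_ppClean D h)

/-- **LEMMA L proper** (kernel, 0 sorry): clause (c) ⟹ the aggregated leg inequality. -/
theorem lemmaL_lawC (D : DepthBoundA4.Design) (h : Q1Kernel.LawC D) : Q1Kernel.LegIneq D := Q1Kernel.legIneq_of_lawC h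

/-- **(c) ⟹ the typed leg row** (kernel, 0 sorry), on designs without duplicated N entries. -/
theorem hallPlusLegUp_of_stepC (D : DepthBoundA4.Design) (hN : D.N.Nodup) (h : Q1Kernel.LawC D) : PortHallLeg.HallPlusLegUp D :=
  Q1Kernel.hallPlusLegUp_of_legIneq hN (lemmaL_lawC D h)

/-- **SORRY-FREE COMPOSITION (Prop vocabulary)**: STEP C for every design gives `TheoremQ1N`. -/
theorem theoremQ1N_of (hC : ∀ D : DepthBoundA4.Design, PatternedPorteous.PPClean PatternedPorteous.weakB D → Q1Kernel.LawC D) : TheoremQ1N :=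
  fun D hN hpp => hallPlusLegUp_of_stepC D hN (hC D hpp)

/-- **SORRY-FREE COMPOSITION (negation's vocabulary, = `PortHallG.theoremQ1N_of` with the forward half of `TheoremG`)**. -/
theorem theoremQ1N_of_G_L (hG : ∀ D : DepthBoundA4.Design, PatternedPorteous.PPClean PatternedPorteous.weakB D → PortHallG.GClean D)
    (hL : PortHallG.LemmaL) : TheoremQ1N :=
  fun D hN hpp => hL D hN (hG D hpp)

/-- with negation's `TheoremG` (the iff) in place of its forward half: literally `PortHallG.theoremQ1N_of`, re-derived. -/
theorem theoremQ1N_of_theoremG (hG : PortHallG.TheoremG) : TheoremQ1N :=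
  fun D hN hpp => lemmaL D hN ((hG D).2 hpp)

/-- **`theoremQ1N` — PRESENT, NOT CLOSED** (R19.923 (3), the three-token composition): sorry-tainted through `gClean_of_ppClean` (THEOREM G) and, inside
`lemmaL`, `Q1Kernel.numComp_le_card_labels` (B.5).  Cite only when this module's farm audit shows 0 sorries. -/
theorem theoremQ1N : TheoremQ1N := fun D hN hpp => lemmaL D hN (gClean_of_ppClean D hpp)

/-- the CELL-level guard implies the pair-level one (cf. `nodup_of_cells_nodup` below); corollary form of `theoremQ1N`. -/
theorem theoremQ1Nc : ∀ D : DepthBoundA4.Design, (D.N.map Prod.fst).Nodup → PatternedPorteous.PPClean PatternedPorteous.weakB D →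
    PortHallLeg.HallPlusLegUp D :=
  fun D hN hpp => theoremQ1N D (hN.of_map _) hpp

/-! ### The shadows of record have no duplicated N entries; the consumers -/

theorem shadowLetter_injective : Function.Injective shadowLetter := by
  intro x y h
  have h1 : (shadowLetter x).a = (shadowLetter y).a := by rw [h]
  have h2 : (shadowLetter x).x = (shadowLetter y).x := by rw [h]
  have h3 : (shadowLetter x).y = (shadowLetter y).y := by rw [h]
  simp only [shadowLetter, neg_inj] at h1 h2 h3
  exact Prod.ext h1 (Prod.ext h2 h3)

theorem shadowCell_injective : Function.Injective shadowCell :=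
  fun _ _ h => funext fun f => shadowLetter_injective (congrFun h f)

/-- the letter shadow of a design lists `cfg.lower.toList` (no duplicates) through the injective `shadowCell`: **no duplicated N entries**. -/
theorem shadow_N_nodup (D : Design) : D.shadow.N.Nodup :=
  (Finset.nodup_toList _).map fun _ _ h => shadowCell_injective (Prod.mk.inj h).1

/-- the shadows' normal form (officer (r) ∕ R19.918): even the N-CELLS are pairwise distinct (it implies `shadow_N_nodup`). -/
theorem shadow_N_cells_nodup (D : Design) : (D.shadow.N.map Prod.fst).Nodup := by
  have h : D.shadow.N.map Prod.fst = D.cfg.lower.toList.map shadowCell := by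
    simp [Design.shadow, List.map_map, Function.comp_def]
  rw [h]
  exact (Finset.nodup_toList _).map shadowCell_injective

/-- cell-level distinctness implies the pair-level guard of `TheoremQ1N`. -/
theorem nodup_of_cells_nodup (D : DepthBoundA4.Design) (h : (D.N.map Prod.fst).Nodup) : D.N.Nodup :=
  h.of_map _

/-- **`legRow_of_ppRow_of_q1N_picZero` — the v4 LITERAL consumer** (guard `originPicZeroLaw`; antecedent = `Lines/splitblock.lean` v4 `stub_ppRow`'s
statement, conclusion = `stub_legRow`'s statement; `Nodup` discharged by `shadow_N_nodup`): once `theoremQ1N` is closed,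
`stub_legRow := legRow_of_ppRow_of_q1N_picZero theoremQ1N stub_ppRow`. -/
theorem legRow_of_ppRow_of_q1N_picZero (q1 : TheoremQ1N)
    (hpp : ∀ (E₀ : AbelianVariety ℂ) (ψ₀ : E₀ ⟶ E₀), E₀.dim = 1 → ψ₀ ≫ ψ₀ = -(1 • 𝟙 E₀) →
      ∀ δ : SplitBlockDatum₀ E₀ ψ₀, originPicZeroLaw E₀ ψ₀ δ → δ.Dsh.Positive → δ.Passes → ScopeRows 14 δ.Dsh.shadow →
        lawPP δ.Dsh.shadow) :
    ∀ (E₀ : AbelianVariety ℂ) (ψ₀ : E₀ ⟶ E₀), E₀.dim = 1 → ψ₀ ≫ ψ₀ = -(1 • 𝟙 E₀) →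
      ∀ δ : SplitBlockDatum₀ E₀ ψ₀, originPicZeroLaw E₀ ψ₀ δ → δ.Dsh.Positive → δ.Passes → ScopeRows 14 δ.Dsh.shadow →
        PortHallLeg.HallPlusLegUp δ.Dsh.shadow :=
  fun E₀ ψ₀ hE hψ δ hΛ hpos hδ hsc => q1 _ (shadow_N_nodup δ.Dsh) (hpp E₀ ψ₀ hE hψ δ hΛ hpos hδ hsc)

/-- the v3 literal consumer (guard `originLaw`). -/
theorem legRow_of_ppRow_of_q1N (q1 : TheoremQ1N)
    (hpp : ∀ (E₀ : AbelianVariety ℂ) (ψ₀ : E₀ ⟶ E₀), E₀.dim = 1 → ψ₀ ≫ ψ₀ = -(1 • 𝟙 E₀) →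
      ∀ δ : SplitBlockDatum₀ E₀ ψ₀, originLaw E₀ ψ₀ δ → δ.Dsh.Positive → δ.Passes → ScopeRows 14 δ.Dsh.shadow →
        lawPP δ.Dsh.shadow) :
    ∀ (E₀ : AbelianVariety ℂ) (ψ₀ : E₀ ⟶ E₀), E₀.dim = 1 → ψ₀ ≫ ψ₀ = -(1 • 𝟙 E₀) →
      ∀ δ : SplitBlockDatum₀ E₀ ψ₀, originLaw E₀ ψ₀ δ → δ.Dsh.Positive → δ.Passes → ScopeRows 14 δ.Dsh.shadow →
        PortHallLeg.HallPlusLegUp δ.Dsh.shadow :=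
  fun E₀ ψ₀ hE hψ δ hΛ hpos hδ hsc => q1 _ (shadow_N_nodup δ.Dsh) (hpp E₀ ψ₀ hE hψ δ hΛ hpos hδ hsc)

/-- **GENERIC consumer** (any law `Λ`, any height `h`): `TheoremQ1N` turns the PP row of record into the LEG row of record. -/
theorem rung2b₀Under_legRow_of_ppRow_of_q1N (q1 : TheoremQ1N) {Λ : DatumLaw} {h : ℤ} (hpp : Rung2b₀Under Λ h lawPP) :
    Rung2b₀Under Λ h PortHallLeg.HallPlusLegUp :=
  fun E₀ ψ₀ hE hψ δ hΛ hpos hδ hsc => q1 _ (shadow_N_nodup δ.Dsh) (hpp E₀ ψ₀ hE hψ δ hΛ hpos hδ hsc)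

/-- AUDIT: nothing on the path of 18881 is decided in this file; `theoremQ1N` is sorry-tainted until `stepC_of_ppClean` is filled. -/
theorem audit_nothing_decided_q1Kernel : True := trivial

end Q1Kernel

end SplitBlock

end Summit.HodgeConjecture.HodgeConjecture.Cruxes.BlochSeedDiscOne.SeedChecker
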